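import Literature.Analysis.FluidPDE.TorusStrainVorticityOrthogonality
import Literature.Analysis.FluidPDE.TorusNSMillerCriterion
import Literature.Analysis.FluidPDE.TorusNSEnstrophyContinuation
import Literature.Analysis.FluidPDE.TorusPalinstrophyLadder
import HarnessLib

/-!
# Miller's criterion: regularity while the strain stays close to an eigenfunction of the Laplacian
# (`inf_ρ ‖−ρΔS − S‖_{L^q} ∈ L^p_t`, `2/p + 3/q = 2`), classical solutions on `T³`

Analysis/FluidPDE proof file (theorems only: no definitions, no named facts).
Search for candidate a priori estimates; no regularity claim.

E. Miller, *On the interaction of strain and vorticity for solutions of the Navier–Stokes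
equation*, Pure Appl. Anal. 8 (2026) 247–270 = arXiv:2407.02691:

* **Theorem 1.12 (= Thm 6.1).** "Suppose `u ∈ C([0,T_max);Ḣ¹_{df})` is a mild solution to the
  Navier–Stokes equation, and suppose `2/p + 3/q = 2`, `3/2 < q ≤ +∞`. Then for all
  `0 < t < T_max`, `‖ω(·,t)‖²_{L²} < ‖ω⁰‖²_{L²} exp(C_q ∫₀ᵗ inf_{ρ∈ℝ} ‖−ρΔS − S‖^p_{L^q} dτ)`,
  where `C_q > 0` depends only on `q`. In particular, if `T_max < +∞`, then
  `∫₀^{T_max} inf_{ρ∈ℝ} ‖−ρΔS − S‖^p_{L^q} dt = +∞`."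
* **Theorem 1.13 (= Thm 6.6), the endpoint `q = 3/2`.** "… that blows up in finite time
  `T_max < +∞`. Then `limsup_{t→T_max} inf_{ρ∈ℝ} ‖−ρΔS − S‖_{L^{3/2}} ≥ (1/3)(2/π)^{4/3}`."

Printed proof (§6): the enstrophy balance `d/dt ½‖ω‖²₂ = −‖ω‖²_{Ḣ¹} + ⟨S, ω⊗ω⟩` and the
orthogonality `⟨−ΔS, ω⊗ω⟩ = 0` (Thm 1.3; tree: `TorusStrainVorticityOrthogonality`) give, for EVERY
`ρ ∈ ℝ`, `d/dt ½‖ω‖² = −‖ω‖²_{Ḣ¹} − ⟨−ρΔS − S, ω⊗ω⟩ ≤ −‖ω‖²_{Ḣ¹} + ‖−ρΔS − S‖_{L^q}‖ω‖²_{L^{2r}}`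
(`1/q + 1/r = 1`); `q = ∞`: Grönwall directly; `3/2 < q < ∞`: interpolate `‖ω‖_{L^{2r}}` between
`L²` and `L⁶`, Sobolev, Young with exponents `p` and `b`; `q = 3/2`: Hölder `(3/2, 6, 6)` and the
Sobolev bound `‖ω‖²_{L⁶} ≤ 3(π/2)^{4/3}‖ω‖²_{Ḣ¹}` as printed in the proof of Thm 6.6, so that
`d/dt‖ω‖² < 0` as soon as `3(π/2)^{4/3} inf_ρ‖−ρΔS − S‖_{3/2} < 1`. DISCLOSURE (referee R92,
finding F92.2): the constant `3(π/2)^{4/3} ≈ 5.48` used in that printed step is the RECIPROCAL of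
the sharp Talenti/Lieb value `C₁² = (1/3)(2/π)^{4/3} ≈ 0.18` of the paper's own Theorem 2.6
(`‖f‖_{L⁶} ≤ 3^{−1/2}(2/π)^{2/3}‖f‖_{Ḣ¹}`), hence a valid but non-sharp Sobolev bound; the printed
threshold `(1/3)(2/π)^{4/3}` of Theorem 1.13 is therefore correct but not optimal (the sharp
constant would give `3(π/2)^{4/3}`). The torus statements below are `∃ c > 0` and are unaffected.

Here, on the unit torus `T^d`, `card d = 3`, for CLASSICAL solutions of the unforced system
(`Torus.IsClassicalNSSolutionOn … ν 0 u p`), in the house form of the census's other criteria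
(`TorusNSMillerCriterion`, `MillerMiddleEigenvalueTorus`): the shift `ρ` is a free real parameter
(time-dependent `ρ(t)` allowed, no regularity needed — the infimum over `ρ` is realised by
quantifying over all `ρ`), and the `L^q` norm of the matrix field `−ρΔS − S` is placed on a
continuous pointwise majorant `Λ(x) ≥ |S(x) + ρΔS(x)|_F` (Frobenius norm of
`Sₐᵦ + ρ(ΔS)ₐᵦ`, `Sₐᵦ = ½((∂ᵦv)ₐ + (∂ₐv)ᵦ)`, `(ΔS)ₐᵦ = ½((∂ₐΔv)ᵦ + (∂ᵦΔv)ₐ)`; e.g.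
`Λ = |S + ρΔS|_F` itself, which is continuous):

* `Torus.IsClassicalNSSolutionOn.enstrophyRate_le_of_shiftedStrain_sup` — `q = ∞`, rate form:
  `|S + ρΔS|_F ≤ Λ` on `T³` at time `t` ⇒ every one-sided derivative `R` of `ℰ = ½‖∇u‖₂²`
  satisfies `R ≤ −ν‖Δu‖₂² + 2Λℰ` (`∫|ω|² = 2ℰ`);
* `torusEnstrophy_le_mul_exp_integral_shiftedStrainBound` — `q = ∞`, Grönwall form (1.35):
  `ℰ(u t) ≤ ℰ(u a) exp(2∫ₐᵗ Λ)` (`ν ≥ 0`, Euler included);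
* `Torus.exists_enstrophyFlux_le_of_shiftedStrain_Lq_le` — `3/2 < q < ∞`, the flux bound:
  `∃ K ≥ 0`, `(∫Λ^q)^{1/q} ≤ N ⇒ −ν‖Δv‖₂² + ∫⟪(v·∇)v, Δv⟫ ≤ K N^{2q/(2q−3)}‖∇v‖₂²`
  (`p = 2q/(2q−3)`);
* `Torus.classicalNS_continuation_of_shiftedStrain_Lq_rpow_integral_le` — `3/2 < q < ∞`,
  continuation form: `∫₀ᵗ N^p ≤ I` on `[0, T)` ⇒ the classical solution continues past `T`;
  `Torus.classicalNS_continuation_of_shiftedStrain_integral_le` — the same at `q = ∞`;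
* `Torus.exists_enstrophyFlux_nonpos_of_shiftedStrain_L32_small` and
  `Torus.classicalNS_continuation_of_shiftedStrain_L32_small` — the endpoint `q = 3/2`
  (Thm 1.13) with the torus constant: `∃ c > 0` (from the `T³` Sobolev constant of
  `Torus.exists_integral_gradSq_cube_le_laplacianSq_cube`) such that
  `(∫Λ^{3/2})^{2/3} ≤ c·ν ⇒` the enstrophy flux is `≤ 0`, hence continuation.
  TODO(general form): the printed threshold `(1/3)(2/π)^{4/3}` (at `ν = 1`; numerically the
  sharp `ℝ³` Sobolev constant `C₁²`, obtained in print from the non-sharp bound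
  `‖ω‖₆² ≤ 3(π/2)^{4/3}‖ω‖²_{Ḣ¹}`, see the DISCLOSURE above) and any explicit unit-torus constant
  are not computed here;
* `Torus.iInf_integral_sum_shiftedStrain_sq_eq` — **Proposition 6.2** ("`inf_ρ ‖−ρΔS − S‖²₂ =
  (1 − ‖S‖⁴_{Ḣ¹}/(‖S‖²₂‖−ΔS‖²₂))‖S‖²₂`") on `T^d` (any `d`) in the ladder variables of
  Doering–Gibbon: `⨅ ρ, ∫∑ₐᵦ(Sₐᵦ + ρ(ΔS)ₐᵦ)² = ½(H₁ − H₂²/H₃)`, `H₁ = ‖∇v‖₂²`, `H₂ = ‖Δv‖₂²`,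
  `H₃ = ‖∇Δv‖₂²` (torus strain isometries `‖S‖²₂ = ½H₁`, `⟨S, ΔS⟩ = −½H₂`, `‖ΔS‖²₂ = ½H₃`:
  `StrainAlmostEigen.integral_sum_shiftedStrain_sq_eq`, `…integral_sum_strain_mul_laplacianStrain_eq`,
  `…integral_sum_laplacianStrain_sq_eq`); the defect `H₁ − H₂²/H₃ ≥ 0` is the ladder
  interpolation `H₂² ≤ H₁H₃` (`Torus.sq_integral_norm_sq_laplacian_le`);
* `Torus.exists_enstrophyFlux_le_of_ladderDefect` — **Corollary 6.3** at `q = 2` (`p = 4`) as a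
  flux bound: `∃ K ≥ 0`, `−ν‖Δv‖₂² + ∫⟪(v·∇)v, Δv⟫ ≤ K (½(H₁ − H₂²/H₃))² ‖∇v‖₂²` for every smooth
  divergence-free `v` on `T³` (optimal shift `ρ₀ = H₂/H₃`, exact majorant `Λ = |S + ρ₀ΔS|_F`).

Scope (faithfulness): classical solutions with mean-zero slices on the unit torus (the printed
setting is mild `Ḣ¹` solutions on `ℝ³`); Frobenius matrix norm; the `L^p_t` hypothesis is placed on
a time-continuous majorant `N(t) ≥ ‖Λ(t)‖_{L^q}` with bounded primitive of `N^p`, exactly as in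
`TorusNSMillerCriterion`. Nothing about regularity of Navier–Stokes follows beyond the printed
criterion; these are conditional continuation statements.

These serve the functional-mining cell (pub-nsfunc): CRITERIA row A20 (a new admissible
right-hand side `inf_ρ ‖S + ρΔS‖_{L^q}^p`, `2/p + 3/q = 2`, for census rows of enstrophy type) and the
dictionary's strain family ES (the defect from a Laplacian eigenfield as a depletion diagnostic).

## Mathlib / tree search

Tree (used): `StrainVorticityOrthogonality.integral_inner_convect_laplacian_eq_integral_shifted`
(this seat, Miller Thm 1.3), `torusVorticitySqAt_eq_sum_sq_of_equiv`,
`integral_torusVorticitySqAt_eq_two_mul_torusEnstrophy`, `torusVorticitySqAt_le_two_mul_sum_norm_sq`,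
`Torus.IsClassicalNSSolutionOn.hasDerivWithinAt_half_gradNormSq`,
`le_mul_exp_integral_of_hasDerivWithinAt_le_mul`, `Torus.integral_rpow_le_interpolate_two_six'`,
`Torus.exists_integral_gradSq_cube_le_laplacianSq_cube`, `Torus.classicalNS_continuation_of_enstrophyFlux_le`,
`integral_strainNormSq_eq_torusEnstrophy`, `Torus.sq_integral_norm_sq_laplacian_le` (`TorusPalinstrophyLadder`);
Mathlib `Real.sum_mul_le_sqrt_mul_sqrt`, `integral_mul_le_Lp_mul_Lq_of_nonneg`,
`Real.geom_mean_le_arith_mean2_weighted`. Searched: `shiftedStrain|AlmostEigen|rho.*laplacian.*strain`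
— nothing in the tree.

## References

* [Miller2026StrainVorticity] E. Miller, Pure Appl. Anal. 8 (2026), no. 1, 247–270,
  doi:10.2140/paa.2026.8.247 = arXiv:2407.02691; Thm 1.12 / Thm 6.1 and Thm 1.13 / Thm 6.6 with
  proofs, Prop 6.2 / Cor 6.3 (held text paper:arxiv-2407.02691, chunks 6 and 15–19).
* [Miller2019] E. Miller, Arch. Ration. Mech. Anal. 235 (2020) 99–139 (the house pattern:
  `TorusNSMillerCriterion`).
* [RobinsonRodrigoSadowskiCUP2016] Lemma 6.11 (continuation), Lemma 8.16 (interpolation).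
-/

noncomputable section

open Set MeasureTheory intervalIntegral Filter Real Finset
open scoped InnerProductSpace RealInnerProductSpace Topology ENNReal

namespace Literature.Analysis.FluidPDE

open Literature.Analysis.FunctionSpaces StrainVorticityOrthogonality

variable {d : Type*} [Fintype d] [DecidableEq d]

namespace StrainAlmostEigen

/-! ### Pointwise: `ωᵀMω ≤ |M|_F |ω|²` -/

omit [DecidableEq d] in
/-- Cauchy–Schwarz for a quadratic form: `∑ₐᵦ wₐ Mₐᵦ w_b ≤ (∑ₐᵦ Mₐᵦ²)^{1/2} ∑ₐ wₐ²`. [folklore] -/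
private theorem quadForm_le_sqrt_mul (w : d → ℝ) (M : d → d → ℝ) :
    ∑ a, ∑ b, w a * M a b * w b ≤ Real.sqrt (∑ a, ∑ b, M a b ^ 2) * ∑ a, w a ^ 2 := by
  have h := Real.sum_mul_le_sqrt_mul_sqrt (Finset.univ : Finset (d × d))
    (fun q => M q.1 q.2) (fun q => w q.1 * w q.2)
  have e1 : ∑ q : d × d, M q.1 q.2 * (w q.1 * w q.2) = ∑ a, ∑ b, w a * M a b * w b := by
    rw [Fintype.sum_prod_type]
    exact Finset.sum_congr rfl fun a _ => Finset.sum_congr rfl fun b _ => by ring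
  have e2 : ∑ q : d × d, M q.1 q.2 ^ 2 = ∑ a, ∑ b, M a b ^ 2 := by
    rw [Fintype.sum_prod_type]
  have e3 : ∑ q : d × d, (w q.1 * w q.2) ^ 2 = (∑ a, w a ^ 2) ^ 2 := by
    rw [Fintype.sum_prod_type, sq, Finset.sum_mul_sum]
    exact Finset.sum_congr rfl fun a _ => Finset.sum_congr rfl fun b _ => by ring
  rw [e1, e2, e3, Real.sqrt_sq (Finset.sum_nonneg fun a _ => sq_nonneg _)] at h
  exact h

/-- **`ωᵀ(S + ρΔS)ω ≤ Λ|ω|²` pointwise** under a Frobenius majorant `∑ₐᵦ(Sₐᵦ + ρ(ΔS)ₐᵦ)² ≤ Λ²`,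
`Λ ≥ 0` (`card d = 3`, any labelling `e`; `|ω|² = torusVorticitySqAt`). The Hölder step
"`−⟨−ρΔS − S, ω⊗ω⟩ ≤ ‖−ρΔS − S‖_{L^∞}‖ω‖²_{L²}`" of Miller's proof, pointwise.
[cite: Miller2026StrainVorticity, §6, proof of Thm 6.1 (case q = ∞)] -/
theorem sum_vorticity_shiftedStrain_vorticity_le (e : d ≃ Fin 3)
    (v : UnitAddTorus d → EuclideanSpace ℝ d) (ρ : ℝ) (x : UnitAddTorus d) {Λ : ℝ} (hΛ0 : 0 ≤ Λ)
    (hΛ : ∑ a, ∑ b, ((Torus.partialDeriv b v x a + Torus.partialDeriv a v x b) / 2 +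
        ρ * ((Torus.partialDeriv a (Torus.laplacian v) x b +
          Torus.partialDeriv b (Torus.laplacian v) x a) / 2)) ^ 2 ≤ Λ ^ 2) :
    ∑ a, ∑ b, torusVorticityTensor v (e.symm (e a + 1)) (e.symm (e a + 2)) x *
        ((Torus.partialDeriv b v x a + Torus.partialDeriv a v x b) / 2 +
          ρ * ((Torus.partialDeriv a (Torus.laplacian v) x b +
            Torus.partialDeriv b (Torus.laplacian v) x a) / 2)) *
        torusVorticityTensor v (e.symm (e b + 1)) (e.symm (e b + 2)) x ≤
      Λ * torusVorticitySqAt v x := by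
  set w : d → ℝ := fun a => torusVorticityTensor v (e.symm (e a + 1)) (e.symm (e a + 2)) x with hw
  set M : d → d → ℝ := fun a b => (Torus.partialDeriv b v x a + Torus.partialDeriv a v x b) / 2 +
    ρ * ((Torus.partialDeriv a (Torus.laplacian v) x b +
      Torus.partialDeriv b (Torus.laplacian v) x a) / 2) with hM
  have h1 := quadForm_le_sqrt_mul w M
  have hsq : Real.sqrt (∑ a, ∑ b, M a b ^ 2) ≤ Λ := by
    rw [← Real.sqrt_sq hΛ0]
    exact Real.sqrt_le_sqrt hΛ
  have hw2 : ∑ a, w a ^ 2 = torusVorticitySqAt v x := by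
    rw [torusVorticitySqAt_eq_sum_sq_of_equiv e v x]
  have hw0 : 0 ≤ ∑ a, w a ^ 2 := Finset.sum_nonneg fun a _ => sq_nonneg _
  calc ∑ a, ∑ b, w a * M a b * w b ≤ Real.sqrt (∑ a, ∑ b, M a b ^ 2) * ∑ a, w a ^ 2 := h1
    _ ≤ Λ * ∑ a, w a ^ 2 := mul_le_mul_of_nonneg_right hsq hw0
    _ = Λ * torusVorticitySqAt v x := by rw [hw2]

/-- Continuity of the shifted quadratic form `x ↦ ωᵀ(S + ρΔS)ω` of a smooth field. [folklore] -/
private theorem continuous_quadForm (e : d ≃ Fin 3) {v : UnitAddTorus d → EuclideanSpace ℝ d}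
    (hv : Torus.IsSmooth v) (ρ : ℝ) :
    Continuous fun x => ∑ a, ∑ b, torusVorticityTensor v (e.symm (e a + 1)) (e.symm (e a + 2)) x *
        ((Torus.partialDeriv b v x a + Torus.partialDeriv a v x b) / 2 +
          ρ * ((Torus.partialDeriv a (Torus.laplacian v) x b +
            Torus.partialDeriv b (Torus.laplacian v) x a) / 2)) *
        torusVorticityTensor v (e.symm (e b + 1)) (e.symm (e b + 2)) x := by
  have hW : ∀ a b, Continuous (torusVorticityTensor v a b) := fun a b =>
    (((hv.partialDeriv a).apply b).sub ((hv.partialDeriv b).apply a)).continuous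
  have hD : ∀ a b, Continuous fun y => Torus.partialDeriv a v y b := fun a b =>
    ((hv.partialDeriv a).apply b).continuous
  have hDL : ∀ a b, Continuous fun y => Torus.partialDeriv a (Torus.laplacian v) y b := fun a b =>
    ((hv.laplacian.partialDeriv a).apply b).continuous
  refine continuous_finsetSum _ fun a _ => continuous_finsetSum _ fun b _ => ?_
  exact ((hW _ _).mul ((((hD b a).add (hD a b)).div_const 2).add
    ((((hDL a b).add (hDL b a)).div_const 2).const_mul ρ))).mul (hW _ _)

/-- Continuity of `|ω|²` of a smooth field. [folklore] -/
private theorem continuous_torusVorticitySqAt {v : UnitAddTorus d → EuclideanSpace ℝ d}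
    (hv : Torus.IsSmooth v) : Continuous (torusVorticitySqAt v) := by
  have hD : ∀ a b, Continuous fun y => Torus.partialDeriv a v y b := fun a b =>
    ((hv.partialDeriv a).apply b).continuous
  unfold torusVorticitySqAt
  exact continuous_const.mul (continuous_finsetSum _ fun i _ => continuous_finsetSum _ fun j _ =>
    ((hD i j).sub (hD j i)).pow 2)

/-- **The inertial term under a Frobenius majorant of the shifted strain**: for smooth
divergence-free `v` on `T^d`, `card d = 3`, every `ρ`, and `Λ : T^d → ℝ` continuous, nonnegative,
with `∑ₐᵦ(Sₐᵦ + ρ(ΔS)ₐᵦ)²(x) ≤ Λ(x)²`: `∫⟪(v·∇)v, Δv⟫ ≤ ∫ Λ |ω|²` (Miller's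
`⟨S, ω⊗ω⟩ = −⟨−ρΔS − S, ω⊗ω⟩ ≤ ∫ |−ρΔS − S| |ω|²`). [cite: Miller2026StrainVorticity, §6, proof of Thm 6.1, display (6.5)] -/
theorem integral_inner_convect_laplacian_le_integral_majorant_mul (hd : Fintype.card d = 3)
    {v : UnitAddTorus d → EuclideanSpace ℝ d} (hv : Torus.IsSmooth v) (hdiv : Torus.IsDivFree v)
    (ρ : ℝ) {Λ : UnitAddTorus d → ℝ} (hΛc : Continuous Λ) (hΛ0 : ∀ x, 0 ≤ Λ x)
    (hΛ : ∀ x, ∑ a, ∑ b, ((Torus.partialDeriv b v x a + Torus.partialDeriv a v x b) / 2 +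
        ρ * ((Torus.partialDeriv a (Torus.laplacian v) x b +
          Torus.partialDeriv b (Torus.laplacian v) x a) / 2)) ^ 2 ≤ Λ x ^ 2) :
    ∫ x, ⟪Torus.convect v v x, Torus.laplacian v x⟫_ℝ ≤ ∫ x, Λ x * torusVorticitySqAt v x := by
  set e : d ≃ Fin 3 := Fintype.equivFinOfCardEq hd with he
  rw [integral_inner_convect_laplacian_eq_integral_shifted e hv hdiv ρ]
  exact integral_mono (continuous_quadForm e hv ρ).integrable_unitAddTorus
    (hΛc.mul (continuous_torusVorticitySqAt hv)).integrable_unitAddTorus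
    (fun x => sum_vorticity_shiftedStrain_vorticity_le e v ρ x (hΛ0 x) (hΛ x))

end StrainAlmostEigen

open StrainAlmostEigen

/-! ### `q = ∞`: rate form and Grönwall form (Theorem 1.12, case `q = ∞`) -/

/-- **Miller's Theorem 1.12 at `q = ∞`, rate form, on `T³`**: along a classical solution of the
unforced Navier–Stokes equations on `T^d × [a, b]` (`card d = 3`, `a < b`, any `ν`, Euler
included), at `t ∈ [a, b]`: if for some `ρ ∈ ℝ` the shifted strain has Frobenius norm
`|S(t,x) + ρΔS(t,x)|_F ≤ Λ` at every `x` (`0 ≤ Λ`), then every one-sided derivative `R` of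
`s ↦ ℰ(u s) = ½‖∇u(s)‖₂²` within `[a, b]` at `t` satisfies `R ≤ −ν‖Δu(t)‖₂² + 2Λ ℰ(u t)`
("`d/dt ‖ω‖²₂ ≤ 2 inf_ρ ‖−ρΔS − S‖_{L^∞} ‖ω‖²₂`", display (6.7)).
[cite: Miller2026StrainVorticity, Thm 1.12 (= Thm 6.1), case q = ∞, display (6.7)] -/
theorem _root_.Literature.Analysis.FunctionSpaces.Torus.IsClassicalNSSolutionOn.enstrophyRate_le_of_shiftedStrain_sup
    (hd : Fintype.card d = 3) {a b ν : ℝ} {u : ℝ → UnitAddTorus d → EuclideanSpace ℝ d}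
    {p : ℝ → UnitAddTorus d → ℝ} (h : Torus.IsClassicalNSSolutionOn (Icc a b) ν 0 u p)
    (hab : a < b) {t : ℝ} (ht : t ∈ Icc a b) (ρ : ℝ) {Λ : ℝ} (hΛ0 : 0 ≤ Λ)
    (hΛ : ∀ x, ∑ i, ∑ j, ((Torus.partialDeriv j (u t) x i + Torus.partialDeriv i (u t) x j) / 2 +
        ρ * ((Torus.partialDeriv i (Torus.laplacian (u t)) x j +
          Torus.partialDeriv j (Torus.laplacian (u t)) x i) / 2)) ^ 2 ≤ Λ ^ 2)
    (R : ℝ) (hR : HasDerivWithinAt (fun s => torusEnstrophy (u s)) R (Icc a b) t) :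
    R ≤ -ν * (∫ x, ‖Torus.laplacian (u t) x‖ ^ 2) + 2 * Λ * torusEnstrophy (u t) := by
  have hut : Torus.IsSmooth (u t) := h.smooth_velocity.isSmooth_slice ht
  have hdivt : Torus.IsDivFree (u t) := h.divFree t ht
  have hU : UniqueDiffWithinAt ℝ (Icc a b) t := uniqueDiffOn_Icc hab t ht
  have hbal : HasDerivWithinAt (fun s => torusEnstrophy (u s))
      (-ν * (∫ x, ‖Torus.laplacian (u t) x‖ ^ 2) +
        ∫ x, ⟪Torus.convect (u t) (u t) x - (0 : ℝ → UnitAddTorus d → EuclideanSpace ℝ d) t x,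
          Torus.laplacian (u t) x⟫_ℝ) (Icc a b) t :=
    h.hasDerivWithinAt_half_gradNormSq hab ht
  have hReq : R = -ν * (∫ x, ‖Torus.laplacian (u t) x‖ ^ 2) +
      ∫ x, ⟪Torus.convect (u t) (u t) x - (0 : ℝ → UnitAddTorus d → EuclideanSpace ℝ d) t x,
        Torus.laplacian (u t) x⟫_ℝ :=
    (hR.derivWithin hU).symm.trans (hbal.derivWithin hU)
  have hconv : ∫ x, ⟪Torus.convect (u t) (u t) x - (0 : ℝ → UnitAddTorus d → EuclideanSpace ℝ d) t x,
        Torus.laplacian (u t) x⟫_ℝ = ∫ x, ⟪Torus.convect (u t) (u t) x, Torus.laplacian (u t) x⟫_ℝ := by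
    refine integral_congr_ae (Filter.Eventually.of_forall fun x => ?_)
    simp only [Pi.zero_apply, sub_zero]
  have hin := integral_inner_convect_laplacian_le_integral_majorant_mul hd hut hdivt ρ
    (Λ := fun _ => Λ) continuous_const (fun _ => hΛ0) hΛ
  have hω : ∫ x, Λ * torusVorticitySqAt (u t) x = 2 * Λ * torusEnstrophy (u t) := by
    rw [MeasureTheory.integral_const_mul, integral_torusVorticitySqAt_eq_two_mul_torusEnstrophy hut hdivt]
    ring
  rw [hReq, hconv]
  linarith [hin, hω.le, hω.ge]

/-- **Miller's Theorem 1.12 at `q = ∞`, Grönwall form (1.35), on `T³`**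
("`‖ω(·,t)‖²₂ ≤ ‖ω⁰‖²₂ exp(2∫₀ᵗ inf_ρ ‖−ρΔS − S‖_{L^∞} dτ)`"): along a classical solution of the
unforced Navier–Stokes equations with `ν ≥ 0` on `T^d × [a, b]` (`card d = 3`, `a < b`), if
`ρ : ℝ → ℝ` is ANY choice of shifts and `Λ : ℝ → ℝ` is continuous and nonnegative on `[a, b]` with
`|S(s,x) + ρ(s)ΔS(s,x)|_F ≤ Λ(s)` for all `s ∈ [a, b]` and all `x`, then
`ℰ(u t) ≤ ℰ(u a) · exp(2∫ₐᵗ Λ)` for every `t ∈ [a, b]` (`ℰ = ½‖∇u‖₂² = ½‖ω‖₂²`).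
[cite: Miller2026StrainVorticity, Thm 1.12 (= Thm 6.1), case q = ∞, display (1.35)/(6.8)] -/
theorem torusEnstrophy_le_mul_exp_integral_shiftedStrainBound (hd : Fintype.card d = 3)
    {ν a b : ℝ} (hν : 0 ≤ ν) (hab : a < b)
    {u : ℝ → UnitAddTorus d → EuclideanSpace ℝ d} {p : ℝ → UnitAddTorus d → ℝ}
    (h : Torus.IsClassicalNSSolutionOn (Icc a b) ν 0 u p) (ρ : ℝ → ℝ)
    {Λ : ℝ → ℝ} (hΛc : ContinuousOn Λ (Icc a b)) (hΛ0 : ∀ s ∈ Icc a b, 0 ≤ Λ s)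
    (hΛ : ∀ s ∈ Icc a b, ∀ x,
      ∑ i, ∑ j, ((Torus.partialDeriv j (u s) x i + Torus.partialDeriv i (u s) x j) / 2 +
        ρ s * ((Torus.partialDeriv i (Torus.laplacian (u s)) x j +
          Torus.partialDeriv j (Torus.laplacian (u s)) x i) / 2)) ^ 2 ≤ Λ s ^ 2)
    {t : ℝ} (ht : t ∈ Icc a b) :
    torusEnstrophy (u t) ≤ torusEnstrophy (u a) * Real.exp (2 * ∫ s in a..t, Λ s) := by
  set G : ℝ → ℝ := fun s => -ν * (∫ x, ‖Torus.laplacian (u s) x‖ ^ 2) +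
      ∫ x, ⟪Torus.convect (u s) (u s) x - (0 : ℝ → UnitAddTorus d → EuclideanSpace ℝ d) s x,
        Torus.laplacian (u s) x⟫_ℝ with hG
  have hder : ∀ s ∈ Icc a b,
      HasDerivWithinAt (fun r => torusEnstrophy (u r)) (G s) (Icc a b) s :=
    fun s hs => h.hasDerivWithinAt_half_gradNormSq hab hs
  have hle : ∀ s ∈ Icc a b, G s ≤ (2 * Λ s) * torusEnstrophy (u s) := by
    intro s hs
    have h1 := h.enstrophyRate_le_of_shiftedStrain_sup hd hab hs (ρ s) (hΛ0 s hs) (hΛ s hs) (G s)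
      (hder s hs)
    have hdiss : 0 ≤ ν * ∫ x, ‖Torus.laplacian (u s) x‖ ^ 2 :=
      mul_nonneg hν (integral_nonneg fun x => sq_nonneg _)
    linarith
  have hk : ContinuousOn (fun s => 2 * Λ s) (Icc a b) := continuousOn_const.mul hΛc
  have hmain := le_mul_exp_integral_of_hasDerivWithinAt_le_mul hab hder hk hle ht
  rwa [intervalIntegral.integral_const_mul] at hmain


/-! ### `q = ∞`: continuation form -/

/-- **Miller's Theorem 1.12 at `q = ∞`, continuation form on `T³`**: a classical solution of
the unforced Navier–Stokes equations (`ν > 0`) on `[0, T) × T^d` (`card d = 3`, `T > 0`) with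
mean-zero slices, shifts `ρ : ℝ → ℝ`, and a continuous nonnegative `Λ` on `[0, T)` with
`|S(t,·) + ρ(t)ΔS(t,·)|_F ≤ Λ(t)` pointwise and `∫₀ᵗ Λ ≤ I` for all `t ∈ [0, T)`, continues to a
classical solution with mean-zero slices on some `[0, T']`, `T' > T` ("if `T_max < +∞` then
`∫₀^{T_max} inf_ρ ‖−ρΔS − S‖_{L^∞} = +∞`", the `q = ∞` member of (1.36)).
[cite: Miller2026StrainVorticity, Thm 1.12 (= Thm 6.1), case q = ∞] -/
theorem Torus.classicalNS_continuation_of_shiftedStrain_integral_le (hd : Fintype.card d = 3)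
    {ν T : ℝ} (hν : 0 < ν) (hT : 0 < T) {u : ℝ → UnitAddTorus d → EuclideanSpace ℝ d}
    {p : ℝ → UnitAddTorus d → ℝ} (h : Torus.IsClassicalNSSolutionOn (Ico 0 T) ν 0 u p)
    (hmean : ∀ t ∈ Ico 0 T, Torus.HasZeroMean (u t)) (ρ : ℝ → ℝ) {Λ : ℝ → ℝ}
    (hΛc : ContinuousOn Λ (Ico 0 T)) (hΛ0 : ∀ t ∈ Ico 0 T, 0 ≤ Λ t)
    (hΛ : ∀ t ∈ Ico 0 T, ∀ x,
      ∑ i, ∑ j, ((Torus.partialDeriv j (u t) x i + Torus.partialDeriv i (u t) x j) / 2 +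
        ρ t * ((Torus.partialDeriv i (Torus.laplacian (u t)) x j +
          Torus.partialDeriv j (Torus.laplacian (u t)) x i) / 2)) ^ 2 ≤ Λ t ^ 2)
    {I : ℝ} (hI : ∀ t ∈ Ico 0 T, ∫ s in (0 : ℝ)..t, Λ s ≤ I) :
    ∃ T' : ℝ, T < T' ∧ ∃ (u' : ℝ → UnitAddTorus d → EuclideanSpace ℝ d)
      (p' : ℝ → UnitAddTorus d → ℝ), Torus.IsClassicalNSSolutionOn (Icc 0 T') ν 0 u' p' ∧
        (∀ t ∈ Icc 0 T', Torus.HasZeroMean (u' t)) ∧ ∀ t ∈ Ico 0 T, u' t = u t := by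
  refine Torus.classicalNS_continuation_of_enstrophyFlux_le hd hν hT h hmean
    (g := fun t => 2 * Λ t) (continuousOn_const.mul hΛc) (fun t ht => ?_)
    (I := 2 * I) (fun t ht => ?_)
  · have hut : Torus.IsSmooth (u t) := h.smooth_velocity.isSmooth_slice ht
    have hdivt : Torus.IsDivFree (u t) := h.divFree t ht
    have hin := integral_inner_convect_laplacian_le_integral_majorant_mul hd hut hdivt (ρ t)
      (Λ := fun _ => Λ t) continuous_const (fun _ => hΛ0 t ht) (hΛ t ht)
    have hω : ∫ x, Λ t * torusVorticitySqAt (u t) x = Λ t * Torus.gradNormSq (u t) := by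
      rw [MeasureTheory.integral_const_mul, integral_torusVorticitySqAt_eq_two_mul_torusEnstrophy hut hdivt,
        torusEnstrophy]
      ring
    have hdiss : 0 ≤ ν * ∫ x, ‖Torus.laplacian (u t) x‖ ^ 2 :=
      mul_nonneg hν.le (integral_nonneg fun x => sq_nonneg _)
    have e : Λ t * Torus.gradNormSq (u t) = 2 * Λ t * (2⁻¹ * Torus.gradNormSq (u t)) := by ring
    linarith [hin, hω.le, e.le]
  · rw [intervalIntegral.integral_const_mul]
    exact mul_le_mul_of_nonneg_left (hI t ht) (by norm_num)

namespace StrainAlmostEigen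

/-! ### `3/2 < q < ∞`: the flux bound -/

omit [DecidableEq d] in
/-- Hölder for continuous nonnegative functions on `T^d` with real conjugate exponents. [folklore] -/
private theorem integral_mul_le_rpow₃ {f g : UnitAddTorus d → ℝ} (hf : Continuous f)
    (hg : Continuous g) (hf0 : ∀ x, 0 ≤ f x) (hg0 : ∀ x, 0 ≤ g x) {p q : ℝ}
    (hpq : p.HolderConjugate q) :
    ∫ x, f x * g x ≤ (∫ x, f x ^ p) ^ (1 / p) * (∫ x, g x ^ q) ^ (1 / q) :=
  integral_mul_le_Lp_mul_Lq_of_nonneg (μ := volume) hpq (ae_of_all _ hf0) (ae_of_all _ hg0)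
    (hf.memLp_of_hasCompactSupport (HasCompactSupport.of_compactSpace f))
    (hg.memLp_of_hasCompactSupport (HasCompactSupport.of_compactSpace g))

/-- Weighted AM–GM in the form used for the flux: with `α + β = 1`, `α, β > 0`, `ν > 0`,
`M, G, P ≥ 0`, `−νP + M G^α P^β ≤ α (M^{1/α} ν^{−β/α}) G` (Young's inequality "with exponents `p`
and `b`", Miller's proof of Thm 6.1). [folklore] -/
private theorem flux_amgm₃ {ν α β M G P : ℝ} (hν : 0 < ν) (hα0 : 0 < α) (hβ0 : 0 < β)
    (hαβ : α + β = 1) (hM0 : 0 ≤ M) (hG0 : 0 ≤ G) (hP0 : 0 ≤ P) :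
    -ν * P + M * G ^ α * P ^ β ≤ α * (M ^ α⁻¹ * (ν ^ (β / α))⁻¹) * G := by
  set X : ℝ := M ^ α⁻¹ * (ν ^ (β / α))⁻¹ * G with hX
  set Y : ℝ := ν * P with hY
  have hX0 : 0 ≤ X := by positivity
  have hY0 : 0 ≤ Y := by positivity
  have hAMGM := Real.geom_mean_le_arith_mean2_weighted hα0.le hβ0.le hX0 hY0 hαβ
  have hXα : X ^ α = M * (ν ^ β)⁻¹ * G ^ α := by
    rw [hX, Real.mul_rpow (by positivity) hG0, Real.mul_rpow (by positivity) (by positivity),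
      Real.inv_rpow (by positivity), ← Real.rpow_mul hν.le, Real.rpow_inv_rpow hM0 hα0.ne']
    congr 2
    rw [div_mul_cancel₀ β hα0.ne']
  have hYβ : Y ^ β = ν ^ β * P ^ β := by rw [hY, Real.mul_rpow hν.le hP0]
  have hprod : X ^ α * Y ^ β = M * G ^ α * P ^ β := by
    rw [hXα, hYβ]
    have hνβ : (ν ^ β)⁻¹ * ν ^ β = 1 := inv_mul_cancel₀ (Real.rpow_pos_of_pos hν β).ne'
    calc M * (ν ^ β)⁻¹ * G ^ α * (ν ^ β * P ^ β)
        = M * ((ν ^ β)⁻¹ * ν ^ β) * G ^ α * P ^ β := by ring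
      _ = M * G ^ α * P ^ β := by rw [hνβ, mul_one]
  rw [hprod] at hAMGM
  have hβ1 : β ≤ 1 := by linarith
  have hβY : β * Y ≤ Y := mul_le_of_le_one_left hY0 hβ1
  have hXdef : α * X = α * (M ^ α⁻¹ * (ν ^ (β / α))⁻¹) * G := by rw [hX]; ring
  rw [← hXdef]
  linarith

end StrainAlmostEigen

/-- **The enstrophy flux under `‖ |S + ρΔS|_F ‖_{L^q} ≤ N`, `3/2 < q < ∞`** (Miller, PAA 2026,
proof of Thm 6.1: `d/dt ½‖ω‖² ≤ −‖ω‖²_{Ḣ¹} + ‖−ρΔS − S‖_{L^q}‖ω‖²_{L^{2r}}`, interpolation of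
`L^{2r}` between `L²` and `L⁶`, Sobolev, "Young's inequality with exponents `p, b`"): on `T^d`,
`card d = 3`, for `3/2 < q` and `ν > 0` there is `K ≥ 0` such that for every smooth
divergence-free `v`, every `ρ ∈ ℝ`, every continuous `Λ ≥ 0` on `T^d` with
`∑ₐᵦ(Sₐᵦ + ρ(ΔS)ₐᵦ)² ≤ Λ²` pointwise, and every `N ≥ (∫Λ^q)^{1/q}`:
`−ν‖Δv‖₂² + ∫⟪(v·∇)v, Δv⟫ ≤ K N^{2q/(2q−3)} ‖∇v‖₂²` (`p = 2q/(2q−3)`, `2/p + 3/q = 2`).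
[cite: Miller2026StrainVorticity, Thm 1.12 (= Thm 6.1), proof, case 3/2 < q < ∞] -/
theorem Torus.exists_enstrophyFlux_le_of_shiftedStrain_Lq_le (hd : Fintype.card d = 3)
    {q ν : ℝ} (hq : 3 / 2 < q) (hν : 0 < ν) :
    ∃ K : ℝ, 0 ≤ K ∧ ∀ (v : UnitAddTorus d → EuclideanSpace ℝ d), Torus.IsSmooth v →
      Torus.IsDivFree v → ∀ (ρ : ℝ) (Λ : UnitAddTorus d → ℝ), Continuous Λ → (∀ x, 0 ≤ Λ x) →
      (∀ x, ∑ a, ∑ b, ((Torus.partialDeriv b v x a + Torus.partialDeriv a v x b) / 2 +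
        ρ * ((Torus.partialDeriv a (Torus.laplacian v) x b +
          Torus.partialDeriv b (Torus.laplacian v) x a) / 2)) ^ 2 ≤ Λ x ^ 2) →
      ∀ N : ℝ, 0 ≤ N → (∫ x, Λ x ^ q) ^ (1 / q) ≤ N →
        -ν * (∫ x, ‖Torus.laplacian v x‖ ^ 2) + ∫ x, ⟪Torus.convect v v x, Torus.laplacian v x⟫_ℝ ≤
          K * N ^ (2 * q / (2 * q - 3)) * Torus.gradNormSq v := by
  obtain ⟨C₆, hC₆0, hC₆⟩ := Torus.exists_integral_gradSq_cube_le_laplacianSq_cube (d := d) hd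
  have hq0 : 0 < q := by linarith
  have hq1 : 0 < q - 1 := by linarith
  have h2q3 : 0 < 2 * q - 3 := by linarith
  -- weights and exponents
  set α : ℝ := (2 * q - 3) / (2 * q) with hα
  set β : ℝ := 3 / (2 * q) with hβ
  set r : ℝ := 2 * q / (2 * q - 3) with hr
  have hα0 : 0 < α := by rw [hα]; positivity
  have hβ0 : 0 < β := by rw [hβ]; positivity
  have hαβ : α + β = 1 := by rw [hα, hβ]; field_simp; ring
  have hαr : α⁻¹ = r := by rw [hα, hr, inv_div]
  set c : ℝ := 2 * C₆ ^ (1 / (2 * q)) with hc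
  have hc0 : 0 ≤ c := by positivity
  set K : ℝ := α * (c ^ r * (ν ^ (β / α))⁻¹) with hK
  have hK0 : 0 ≤ K := by positivity
  refine ⟨K, hK0, fun v hv hdiv ρ Λ hΛc hΛ0 hΛ N hN0 hN => ?_⟩
  -- notation
  set f : UnitAddTorus d → ℝ := fun x => Real.sqrt (∑ j, ‖Torus.partialDeriv j v x‖ ^ 2) with hf
  set θ : UnitAddTorus d → ℝ := fun x => ∑ j, ‖Torus.partialDeriv j v x‖ ^ 2 with hθ
  set G : ℝ := Torus.gradNormSq v with hGdef
  set P : ℝ := ∫ x, ‖Torus.laplacian v x‖ ^ 2 with hPdef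
  have hG0 : 0 ≤ G := Torus.gradNormSq_nonneg _
  have hP0 : 0 ≤ P := integral_nonneg fun x => sq_nonneg _
  have hθ0 : ∀ x, 0 ≤ θ x := fun x => Finset.sum_nonneg fun j _ => sq_nonneg _
  have hDc : ∀ i, Continuous fun x => Torus.partialDeriv i v x :=
    fun i => (hv.partialDeriv i).continuous
  have hθc : Continuous θ := continuous_finsetSum _ fun i _ => ((hDc i).norm).pow 2
  have hfc : Continuous f := Real.continuous_sqrt.comp hθc
  have hf0 : ∀ x, 0 ≤ f x := fun x => Real.sqrt_nonneg _
  have hf2 : ∀ x, f x ^ 2 = θ x := fun x => Real.sq_sqrt (hθ0 x)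
  have hG : ∫ x, f x ^ 2 = G := by simp only [hf2, hθ, hGdef, Torus.gradNormSq]
  have hf6 : ∫ x, f x ^ 6 ≤ C₆ * P ^ 3 := by
    have e : ∀ x, f x ^ 6 = (∑ j, ‖Torus.partialDeriv j v x‖ ^ 2) ^ 3 := fun x => by
      rw [show f x ^ 6 = (f x ^ 2) ^ 3 by ring, hf2]
    simp only [e]
    exact hC₆ v hv
  have hI6 : 0 ≤ ∫ x, f x ^ 6 := integral_nonneg fun x => pow_nonneg (hf0 x) 6
  -- Step 1: `∫⟪(v·∇)v, Δv⟫ ≤ ∫ Λ|ω|² ≤ 2 ∫ Λ θ`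
  have hstep1 : ∫ x, ⟪Torus.convect v v x, Torus.laplacian v x⟫_ℝ ≤ 2 * ∫ x, Λ x * θ x := by
    have h1 := integral_inner_convect_laplacian_le_integral_majorant_mul hd hv hdiv ρ hΛc hΛ0 hΛ
    have h2 : ∫ x, Λ x * torusVorticitySqAt v x ≤ ∫ x, 2 * (Λ x * θ x) := by
      refine integral_mono (hΛc.mul (continuous_torusVorticitySqAt hv)).integrable_unitAddTorus
        (((hΛc.mul hθc).integrable_unitAddTorus).const_mul 2) fun x => ?_
      have hω := torusVorticitySqAt_le_two_mul_sum_norm_sq v x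
      have : Λ x * torusVorticitySqAt v x ≤ Λ x * (2 * θ x) := mul_le_mul_of_nonneg_left hω (hΛ0 x)
      linarith
    rw [MeasureTheory.integral_const_mul] at h2
    exact h1.trans h2
  -- Step 2: Hölder `∫ Λ θ ≤ (∫Λ^q)^{1/q} (∫ θ^{q/(q-1)})^{(q-1)/q}`
  have hpq : q.HolderConjugate (q / (q - 1)) := by
    refine Real.holderConjugate_iff.2 ⟨by linarith, ?_⟩
    field_simp
    ring
  have hH := integral_mul_le_rpow₃ (f := Λ) (g := θ) hΛc hθc hΛ0 hθ0 hpq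
  have eθ : ∀ x, θ x ^ (q / (q - 1)) = f x ^ (2 * q / (q - 1)) := fun x => by
    rw [← hf2 x, show (f x ^ 2 : ℝ) = f x ^ (2 : ℝ) by rw [Real.rpow_two], ← Real.rpow_mul (hf0 x)]
    congr 1; field_simp
  simp only [eθ] at hH
  rw [one_div_div] at hH
  -- Step 3: interpolation with `q̃ = 2q/(q-1) ∈ (2, 6)` and the Sobolev step
  have hq2 : 2 < 2 * q / (q - 1) := by rw [lt_div_iff₀ hq1]; linarith
  have hq6 : 2 * q / (q - 1) < 6 := by rw [div_lt_iff₀ hq1]; linarith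
  have hI := Torus.integral_rpow_le_interpolate_two_six' hq2 hq6 hfc hf0
  rw [hG] at hI
  set Fq : ℝ := ∫ x, f x ^ (2 * q / (q - 1)) with hFq
  have hFq0 : 0 ≤ Fq := integral_nonneg fun x => Real.rpow_nonneg (hf0 x) _
  have x6q : (6 - 2 * q / (q - 1)) / 4 = (2 * q - 3) / (2 * (q - 1)) := by field_simp; ring
  have xq2 : (2 * q / (q - 1) - 2) / 4 = 1 / (2 * (q - 1)) := by field_simp; ring
  rw [x6q, xq2] at hI
  have hFq_le : Fq ^ ((q - 1) / q) ≤ C₆ ^ (1 / (2 * q)) * G ^ α * P ^ β := by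
    have h1 : Fq ≤ G ^ ((2 * q - 3) / (2 * (q - 1))) * (C₆ * P ^ 3) ^ (1 / (2 * (q - 1))) := by
      refine hI.trans (mul_le_mul_of_nonneg_left ?_ (Real.rpow_nonneg hG0 _))
      exact Real.rpow_le_rpow hI6 hf6 (by positivity)
    have h2 := Real.rpow_le_rpow hFq0 h1 (by positivity : (0 : ℝ) ≤ (q - 1) / q)
    refine h2.trans (le_of_eq ?_)
    have hCP : 0 ≤ C₆ * P ^ 3 := by positivity
    rw [Real.mul_rpow (Real.rpow_nonneg hG0 _) (Real.rpow_nonneg hCP _), ← Real.rpow_mul hG0,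
      ← Real.rpow_mul hCP, Real.mul_rpow hC₆0 (by positivity),
      show (P ^ 3 : ℝ) = P ^ (3 : ℝ) by norm_cast, ← Real.rpow_mul hP0]
    have x1 : (2 * q - 3) / (2 * (q - 1)) * ((q - 1) / q) = α := by rw [hα]; field_simp
    have x2 : 1 / (2 * (q - 1)) * ((q - 1) / q) = 1 / (2 * q) := by field_simp
    have x3 : (3 : ℝ) * (1 / (2 * q)) = β := by rw [hβ]; ring
    rw [x1, x2, x3]
    ring
  -- Step 4: `flux ≤ -νP + (c N) G^α P^β`, then AM–GM
  have hT2 : ∫ x, ⟪Torus.convect v v x, Torus.laplacian v x⟫_ℝ ≤ (c * N) * G ^ α * P ^ β := by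
    refine hstep1.trans ?_
    calc 2 * ∫ x, Λ x * θ x ≤ 2 * ((∫ x, Λ x ^ q) ^ (1 / q) * Fq ^ ((q - 1) / q)) :=
          mul_le_mul_of_nonneg_left hH (by norm_num)
      _ ≤ 2 * (N * (C₆ ^ (1 / (2 * q)) * G ^ α * P ^ β)) := by
          refine mul_le_mul_of_nonneg_left ?_ (by norm_num)
          exact mul_le_mul hN hFq_le (Real.rpow_nonneg hFq0 _) hN0
      _ = (c * N) * G ^ α * P ^ β := by rw [hc]; ring
  have hM0 : 0 ≤ c * N := mul_nonneg hc0 hN0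
  have hmain := flux_amgm₃ hν hα0 hβ0 hαβ hM0 hG0 hP0 (M := c * N)
  have hKX : α * ((c * N) ^ α⁻¹ * (ν ^ (β / α))⁻¹) * G = K * N ^ r * G := by
    rw [hαr, hK, Real.mul_rpow hc0 hN0]
    ring
  calc -ν * (∫ x, ‖Torus.laplacian v x‖ ^ 2) + ∫ x, ⟪Torus.convect v v x, Torus.laplacian v x⟫_ℝ
      ≤ -ν * P + (c * N) * G ^ α * P ^ β := by rw [hPdef]; linarith [hT2]
    _ ≤ α * ((c * N) ^ α⁻¹ * (ν ^ (β / α))⁻¹) * G := hmain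
    _ = K * N ^ (2 * q / (2 * q - 3)) * Torus.gradNormSq v := by rw [hKX]

/-! ### `3/2 < q < ∞`: continuation form (Theorem 1.12) -/

/-- **Miller's Theorem 1.12 on `T³`, `3/2 < q < ∞`, continuation form** ("if `T_max < +∞`, then
`∫₀^{T_max} inf_{ρ∈ℝ} ‖−ρΔS − S‖^p_{L^q} dt = +∞`", `2/p + 3/q = 2`). Let `(u, p)` be a classical
solution of the unforced Navier–Stokes equations with `ν > 0` on `[0, T) × T^d`, `card d = 3`,
`T > 0`, with mean-zero velocity slices; let `3/2 < q`, let `ρ : ℝ → ℝ` be any shifts, let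
`Λ(t, ·)` be, for every `t ∈ [0, T)`, a continuous nonnegative function on `T^d` with
`|S(t,x) + ρ(t)ΔS(t,x)|²_F ≤ Λ(t,x)²` at every point, and let `N` be a continuous nonnegative function
on `[0, T)` with `(∫ Λ(t,x)^q dx)^{1/q} ≤ N(t)` and `∫₀ᵗ N^{2q/(2q−3)} ≤ I` for all `t ∈ [0, T)`
(`p = 2q/(2q−3)`). Then the solution continues to a classical solution with mean-zero slices on
some `[0, T'] × T^d`, `T' > T`, equal to `u` on `[0, T)`.
[cite: Miller2026StrainVorticity, Thm 1.12 (= Thm 6.1), case 3/2 < q < ∞] -/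
theorem Torus.classicalNS_continuation_of_shiftedStrain_Lq_rpow_integral_le
    (hd : Fintype.card d = 3) {ν T q : ℝ} (hν : 0 < ν) (hT : 0 < T) (hq : 3 / 2 < q)
    {u : ℝ → UnitAddTorus d → EuclideanSpace ℝ d} {p : ℝ → UnitAddTorus d → ℝ}
    (h : Torus.IsClassicalNSSolutionOn (Ico 0 T) ν 0 u p)
    (hmean : ∀ t ∈ Ico 0 T, Torus.HasZeroMean (u t)) (ρ : ℝ → ℝ) {Λ : ℝ → UnitAddTorus d → ℝ}
    (hΛc : ∀ t ∈ Ico 0 T, Continuous (Λ t)) (hΛ0 : ∀ t ∈ Ico 0 T, ∀ x, 0 ≤ Λ t x)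
    (hΛ : ∀ t ∈ Ico 0 T, ∀ x,
      ∑ i, ∑ j, ((Torus.partialDeriv j (u t) x i + Torus.partialDeriv i (u t) x j) / 2 +
        ρ t * ((Torus.partialDeriv i (Torus.laplacian (u t)) x j +
          Torus.partialDeriv j (Torus.laplacian (u t)) x i) / 2)) ^ 2 ≤ Λ t x ^ 2)
    {N : ℝ → ℝ} (hNc : ContinuousOn N (Ico 0 T)) (hN0 : ∀ t ∈ Ico 0 T, 0 ≤ N t)
    (hN : ∀ t ∈ Ico 0 T, (∫ x, Λ t x ^ q) ^ (1 / q) ≤ N t)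
    {I : ℝ} (hI : ∀ t ∈ Ico 0 T, ∫ τ in (0 : ℝ)..t, N τ ^ (2 * q / (2 * q - 3)) ≤ I) :
    ∃ T' : ℝ, T < T' ∧ ∃ (u' : ℝ → UnitAddTorus d → EuclideanSpace ℝ d)
      (p' : ℝ → UnitAddTorus d → ℝ), Torus.IsClassicalNSSolutionOn (Icc 0 T') ν 0 u' p' ∧
        (∀ t ∈ Icc 0 T', Torus.HasZeroMean (u' t)) ∧ ∀ t ∈ Ico 0 T, u' t = u t := by
  obtain ⟨K, hK0, hK⟩ := Torus.exists_enstrophyFlux_le_of_shiftedStrain_Lq_le (d := d) hd hq hν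
  have h2q3 : 0 < 2 * q - 3 := by linarith
  have hr0 : 0 ≤ 2 * q / (2 * q - 3) := by positivity
  refine Torus.classicalNS_continuation_of_enstrophyFlux_le hd hν hT h hmean
    (g := fun t => 2 * K * N t ^ (2 * q / (2 * q - 3)))
    (continuousOn_const.mul (hNc.rpow_const fun t _ => Or.inr hr0)) (fun t ht => ?_)
    (I := 2 * K * I) (fun t ht => ?_)
  · have hut : Torus.IsSmooth (u t) := h.smooth_velocity.isSmooth_slice ht
    have h1 := hK (u t) hut (h.divFree t ht) (ρ t) (Λ t) (hΛc t ht) (hΛ0 t ht) (hΛ t ht) (N t)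
      (hN0 t ht) (hN t ht)
    have h2 : K * N t ^ (2 * q / (2 * q - 3)) * Torus.gradNormSq (u t) =
        2 * K * N t ^ (2 * q / (2 * q - 3)) * (2⁻¹ * Torus.gradNormSq (u t)) := by ring
    linarith
  · rw [intervalIntegral.integral_const_mul]
    exact mul_le_mul_of_nonneg_left (hI t ht) (by positivity)

/-! ### The endpoint `q = 3/2` (Theorem 1.13) -/

/-- **Miller's Theorem 1.13 on `T³` (endpoint `q = 3/2`), flux form**: on `T^d`, `card d = 3`,
there is `c > 0` (from the unit-torus Sobolev constant of
`Torus.exists_integral_gradSq_cube_le_laplacianSq_cube`; the printed `ℝ³` threshold is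
`(1/3)(2/π)^{4/3}` at `ν = 1` — TODO(general form): the torus constant is not computed) such that
for every `ν > 0`, every smooth divergence-free `v`, every `ρ ∈ ℝ` and every continuous `Λ ≥ 0`
with `∑ₐᵦ(Sₐᵦ + ρ(ΔS)ₐᵦ)² ≤ Λ²` pointwise and `(∫Λ^{3/2})^{2/3} ≤ c·ν`, the enstrophy flux is
nonpositive: `−ν‖Δv‖₂² + ∫⟪(v·∇)v, Δv⟫ ≤ 0` (printed: Hölder `(3/2, 6, 6)`, Sobolev, so that
`d/dt ½‖ω‖² ≤ −‖ω‖²_{Ḣ¹}(1 − 3(π/2)^{4/3} inf_ρ‖−ρΔS − S‖_{3/2}) < 0`).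
[cite: Miller2026StrainVorticity, Thm 1.13 (= Thm 6.6), proof, displays (6.30)–(6.33)] -/
theorem Torus.exists_enstrophyFlux_nonpos_of_shiftedStrain_L32_small (hd : Fintype.card d = 3) :
    ∃ c : ℝ, 0 < c ∧ ∀ {ν : ℝ}, 0 < ν → ∀ (v : UnitAddTorus d → EuclideanSpace ℝ d),
      Torus.IsSmooth v → Torus.IsDivFree v → ∀ (ρ : ℝ) (Λ : UnitAddTorus d → ℝ), Continuous Λ →
      (∀ x, 0 ≤ Λ x) →
      (∀ x, ∑ a, ∑ b, ((Torus.partialDeriv b v x a + Torus.partialDeriv a v x b) / 2 +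
        ρ * ((Torus.partialDeriv a (Torus.laplacian v) x b +
          Torus.partialDeriv b (Torus.laplacian v) x a) / 2)) ^ 2 ≤ Λ x ^ 2) →
      (∫ x, Λ x ^ (3 / 2 : ℝ)) ^ (2 / 3 : ℝ) ≤ c * ν →
        -ν * (∫ x, ‖Torus.laplacian v x‖ ^ 2) + ∫ x, ⟪Torus.convect v v x, Torus.laplacian v x⟫_ℝ ≤ 0 := by
  obtain ⟨C₆, hC₆0, hC₆⟩ := Torus.exists_integral_gradSq_cube_le_laplacianSq_cube (d := d) hd
  set c : ℝ := 1 / (2 * C₆ ^ (1 / 3 : ℝ) + 1) with hc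
  have hden : 0 < 2 * C₆ ^ (1 / 3 : ℝ) + 1 := by positivity
  have hc0 : 0 < c := by rw [hc]; positivity
  refine ⟨c, hc0, fun {ν} hν v hv hdiv ρ Λ hΛc hΛ0 hΛ hsmall => ?_⟩
  set θ : UnitAddTorus d → ℝ := fun x => ∑ j, ‖Torus.partialDeriv j v x‖ ^ 2 with hθ
  set P : ℝ := ∫ x, ‖Torus.laplacian v x‖ ^ 2 with hPdef
  have hP0 : 0 ≤ P := integral_nonneg fun x => sq_nonneg _
  have hθ0 : ∀ x, 0 ≤ θ x := fun x => Finset.sum_nonneg fun j _ => sq_nonneg _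
  have hDc : ∀ i, Continuous fun x => Torus.partialDeriv i v x :=
    fun i => (hv.partialDeriv i).continuous
  have hθc : Continuous θ := continuous_finsetSum _ fun i _ => ((hDc i).norm).pow 2
  -- Step 1: `∫⟪(v·∇)v, Δv⟫ ≤ 2 ∫ Λ θ`
  have hstep1 : ∫ x, ⟪Torus.convect v v x, Torus.laplacian v x⟫_ℝ ≤ 2 * ∫ x, Λ x * θ x := by
    have h1 := integral_inner_convect_laplacian_le_integral_majorant_mul hd hv hdiv ρ hΛc hΛ0 hΛ
    have h2 : ∫ x, Λ x * torusVorticitySqAt v x ≤ ∫ x, 2 * (Λ x * θ x) := by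
      refine integral_mono (hΛc.mul (continuous_torusVorticitySqAt hv)).integrable_unitAddTorus
        (((hΛc.mul hθc).integrable_unitAddTorus).const_mul 2) fun x => ?_
      have hω := torusVorticitySqAt_le_two_mul_sum_norm_sq v x
      have : Λ x * torusVorticitySqAt v x ≤ Λ x * (2 * θ x) := mul_le_mul_of_nonneg_left hω (hΛ0 x)
      linarith
    rw [MeasureTheory.integral_const_mul] at h2
    exact h1.trans h2
  -- Step 2: Hölder `(3/2, 3)`: `∫ Λ θ ≤ (∫Λ^{3/2})^{2/3} (∫θ³)^{1/3}`
  have hpq : (3 / 2 : ℝ).HolderConjugate 3 := by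
    refine Real.holderConjugate_iff.2 ⟨by norm_num, by norm_num⟩
  have hH := integral_mul_le_rpow₃ (f := Λ) (g := θ) hΛc hθc hΛ0 hθ0 hpq
  have e23 : (1 : ℝ) / (3 / 2) = 2 / 3 := by norm_num
  rw [e23] at hH
  -- Step 3: Sobolev `(∫θ³)^{1/3} ≤ C₆^{1/3} P`
  have hθ3 : (∫ x, θ x ^ (3 : ℝ)) ^ (1 / 3 : ℝ) ≤ C₆ ^ (1 / 3 : ℝ) * P := by
    have h1 : ∫ x, θ x ^ (3 : ℝ) ≤ C₆ * P ^ 3 := by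
      have e : ∀ x, θ x ^ (3 : ℝ) = (∑ j, ‖Torus.partialDeriv j v x‖ ^ 2) ^ 3 := fun x => by
        rw [show (3 : ℝ) = ((3 : ℕ) : ℝ) by norm_num, Real.rpow_natCast]
      simp only [e]
      exact hC₆ v hv
    have hI3 : 0 ≤ ∫ x, θ x ^ (3 : ℝ) := integral_nonneg fun x => Real.rpow_nonneg (hθ0 x) _
    calc (∫ x, θ x ^ (3 : ℝ)) ^ (1 / 3 : ℝ) ≤ (C₆ * P ^ 3) ^ (1 / 3 : ℝ) :=
          Real.rpow_le_rpow hI3 h1 (by norm_num)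
      _ = C₆ ^ (1 / 3 : ℝ) * P := by
          rw [Real.mul_rpow hC₆0 (by positivity), show (P ^ 3 : ℝ) = P ^ (3 : ℝ) by norm_cast,
            ← Real.rpow_mul hP0]
          norm_num
  -- Step 4: assemble
  have hΛ32 : 0 ≤ (∫ x, Λ x ^ (3 / 2 : ℝ)) ^ (2 / 3 : ℝ) :=
    Real.rpow_nonneg (integral_nonneg fun x => Real.rpow_nonneg (hΛ0 x) _) _
  have hT : ∫ x, ⟪Torus.convect v v x, Torus.laplacian v x⟫_ℝ ≤ 2 * (c * ν) * (C₆ ^ (1 / 3 : ℝ) * P) := by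
    refine hstep1.trans ?_
    calc 2 * ∫ x, Λ x * θ x
        ≤ 2 * ((∫ x, Λ x ^ (3 / 2 : ℝ)) ^ (2 / 3 : ℝ) * (∫ x, θ x ^ (3 : ℝ)) ^ (1 / 3 : ℝ)) :=
          mul_le_mul_of_nonneg_left hH (by norm_num)
      _ ≤ 2 * ((c * ν) * (C₆ ^ (1 / 3 : ℝ) * P)) := by
          refine mul_le_mul_of_nonneg_left ?_ (by norm_num)
          exact mul_le_mul hsmall hθ3 (Real.rpow_nonneg
            (integral_nonneg fun x => Real.rpow_nonneg (hθ0 x) _) _) (by positivity)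
      _ = 2 * (c * ν) * (C₆ ^ (1 / 3 : ℝ) * P) := by ring
  have hcoef : 2 * c * C₆ ^ (1 / 3 : ℝ) ≤ 1 := by
    rw [hc]
    rw [show 2 * (1 / (2 * C₆ ^ (1 / 3 : ℝ) + 1)) * C₆ ^ (1 / 3 : ℝ) =
      (2 * C₆ ^ (1 / 3 : ℝ)) / (2 * C₆ ^ (1 / 3 : ℝ) + 1) by ring]
    rw [div_le_one hden]
    linarith
  have hkey : 2 * (c * ν) * (C₆ ^ (1 / 3 : ℝ) * P) ≤ ν * P := by
    have : 2 * (c * ν) * (C₆ ^ (1 / 3 : ℝ) * P) = (2 * c * C₆ ^ (1 / 3 : ℝ)) * (ν * P) := by ring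
    rw [this]
    exact mul_le_of_le_one_left (mul_nonneg hν.le hP0) hcoef
  rw [hPdef] at hkey hT
  linarith

/-- **Miller's Theorem 1.13 on `T³`, continuation form**: with `c > 0` from
`Torus.exists_enstrophyFlux_nonpos_of_shiftedStrain_L32_small`, a classical solution of the unforced
Navier–Stokes equations (`ν > 0`) on `[0, T) × T^d` (`card d = 3`, `T > 0`) with mean-zero slices
for which, at every `t ∈ [0, T)`, some shift `ρ(t)` and some continuous `Λ(t, ·) ≥ 0` with
`|S + ρ(t)ΔS|²_F ≤ Λ(t,·)²` have `(∫Λ(t,x)^{3/2}dx)^{2/3} ≤ c·ν`, continues past `T` (the enstrophy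
is non-increasing; printed contrapositive: blow-up forces
`limsup inf_ρ ‖−ρΔS − S‖_{L^{3/2}} ≥ (1/3)(2/π)^{4/3}` on `ℝ³`).
[cite: Miller2026StrainVorticity, Thm 1.13 (= Thm 6.6)] -/
theorem Torus.classicalNS_continuation_of_shiftedStrain_L32_small (hd : Fintype.card d = 3) :
    ∃ c : ℝ, 0 < c ∧ ∀ {ν T : ℝ}, 0 < ν → 0 < T →
      ∀ {u : ℝ → UnitAddTorus d → EuclideanSpace ℝ d} {p : ℝ → UnitAddTorus d → ℝ},
      Torus.IsClassicalNSSolutionOn (Ico 0 T) ν 0 u p → (∀ t ∈ Ico 0 T, Torus.HasZeroMean (u t)) →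
      ∀ (ρ : ℝ → ℝ) (Λ : ℝ → UnitAddTorus d → ℝ), (∀ t ∈ Ico 0 T, Continuous (Λ t)) →
      (∀ t ∈ Ico 0 T, ∀ x, 0 ≤ Λ t x) →
      (∀ t ∈ Ico 0 T, ∀ x,
        ∑ i, ∑ j, ((Torus.partialDeriv j (u t) x i + Torus.partialDeriv i (u t) x j) / 2 +
          ρ t * ((Torus.partialDeriv i (Torus.laplacian (u t)) x j +
            Torus.partialDeriv j (Torus.laplacian (u t)) x i) / 2)) ^ 2 ≤ Λ t x ^ 2) →
      (∀ t ∈ Ico 0 T, (∫ x, Λ t x ^ (3 / 2 : ℝ)) ^ (2 / 3 : ℝ) ≤ c * ν) →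
        ∃ T' : ℝ, T < T' ∧ ∃ (u' : ℝ → UnitAddTorus d → EuclideanSpace ℝ d)
          (p' : ℝ → UnitAddTorus d → ℝ), Torus.IsClassicalNSSolutionOn (Icc 0 T') ν 0 u' p' ∧
            (∀ t ∈ Icc 0 T', Torus.HasZeroMean (u' t)) ∧ ∀ t ∈ Ico 0 T, u' t = u t := by
  obtain ⟨c, hc0, hc⟩ := Torus.exists_enstrophyFlux_nonpos_of_shiftedStrain_L32_small (d := d) hd
  refine ⟨c, hc0, fun {ν T} hν hT {u p} h hmean ρ Λ hΛc hΛ0 hΛ hsmall => ?_⟩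
  refine Torus.classicalNS_continuation_of_enstrophyFlux_le hd hν hT h hmean (g := fun _ => 0)
    continuousOn_const (fun t ht => ?_) (I := 0) (fun t ht => by simp)
  have hut : Torus.IsSmooth (u t) := h.smooth_velocity.isSmooth_slice ht
  have h1 := hc hν (u t) hut (h.divFree t ht) (ρ t) (Λ t) (hΛc t ht) (hΛ0 t ht) (hΛ t ht) (hsmall t ht)
  simpa using h1


/-! ### Proposition 6.2: the explicit infimum at `q = 2`, in the ladder variables `H₁, H₂, H₃` -/

namespace StrainAlmostEigen

/-- Polarised swap identity: `∫ ∑ₐᵦ (∂ₐv)ᵦ (∂ᵦw)ₐ = 0` for smooth `v` and smooth divergence-free `w`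
(`∑ₐ(∂ₐv)ᵦ(∂ᵦw)ₐ = ∑ₐ∂ₐ(vᵦ(∂ᵦw)ₐ)` because `∑ₐ∂ₐ(∂ᵦw)ₐ = ∂ᵦ div w = 0`; the `v = w` case is
`integral_sum_partialDeriv_swap_mul_eq_zero`). [folklore] -/
private theorem integral_sum_partialDeriv_mul_swap_eq_zero {v w : UnitAddTorus d → EuclideanSpace ℝ d}
    (hv : Torus.IsSmooth v) (hw : Torus.IsSmooth w) (hdivw : Torus.IsDivFree w) :
    ∫ x, ∑ a, ∑ b, Torus.partialDeriv a v x b * Torus.partialDeriv b w x a = 0 := by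
  have hv1 : Torus.IsContDiff 1 v := hv.isContDiff (by simp)
  have hw1 : Torus.IsContDiff 1 w := hw.isContDiff (by simp)
  have hDw1 : ∀ m, Torus.IsContDiff 1 (Torus.partialDeriv m w) := fun m =>
    (hw.partialDeriv m).isContDiff (by simp)
  have hDwc : ∀ m j, Torus.IsSmooth (fun y => Torus.partialDeriv m w y j) := fun m j =>
    (hw.partialDeriv m).apply j
  have hDwc1 : ∀ m j, Torus.IsContDiff 1 (fun y => Torus.partialDeriv m w y j) := fun m j =>
    (hDwc m j).isContDiff (by simp)
  have hvc : ∀ b, Torus.IsSmooth (fun y => v y b) := fun b => hv.apply b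
  have hvc1 : ∀ b, Torus.IsContDiff 1 (fun y => v y b) := fun b => (hvc b).isContDiff (by simp)
  have hψ : ∀ b a, Torus.IsSmooth (fun y => v y b * Torus.partialDeriv b w y a) := by
    intro b a
    have h : Torus.IsSmooth (fun y => v y b * Torus.partialDeriv b w y a) := (hvc b).mul (hDwc b a)
    exact h
  have hcomm : ∀ j m k x, Torus.partialDeriv j (fun y => Torus.partialDeriv m w y k) x =
      Torus.partialDeriv m (fun y => Torus.partialDeriv j w y k) x := by
    intro j m k x
    rw [Torus.partialDeriv_apply_coord (hDw1 m), Torus.partialDeriv_apply_coord (hDw1 j),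
      Torus.partialDeriv_comm hw j m x]
  -- pointwise: `∑ₐ (∂ₐv)ᵦ (∂ᵦw)ₐ = ∑ₐ ∂ₐ(vᵦ (∂ᵦw)ₐ)`
  have hA : ∀ b x, ∑ a, Torus.partialDeriv a v x b * Torus.partialDeriv b w x a =
      ∑ a, Torus.partialDeriv a (fun y => v y b * Torus.partialDeriv b w y a) x := by
    intro b x
    have hprod : ∀ a, Torus.partialDeriv a (fun y => v y b * Torus.partialDeriv b w y a) x =
        v x b * Torus.partialDeriv a (fun y => Torus.partialDeriv b w y a) x +
          Torus.partialDeriv a v x b * Torus.partialDeriv b w x a := by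
      intro a
      rw [Torus.partialDeriv_mul (hvc1 b) (hDwc1 b a), Torus.partialDeriv_apply_coord hv1]
    have hvan : ∑ a, Torus.partialDeriv a (fun y => Torus.partialDeriv b w y a) x = 0 := by
      simp_rw [show ∀ a, Torus.partialDeriv a (fun y => Torus.partialDeriv b w y a) x =
          Torus.partialDeriv b (fun y => Torus.partialDeriv a w y a) x from fun a => hcomm a b a x]
      rw [← Torus.partialDeriv_finset_sum Finset.univ (fun a _ => hDwc1 a a)]
      have hdivfun : (fun y => ∑ a, Torus.partialDeriv a w y a) = fun _ => (0 : ℝ) := by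
        funext y
        rw [← Torus.divergence_eq_sum_partialDeriv_apply hw1]
        exact hdivw y
      rw [hdivfun, DoeringGibbon1995.torus_partialDeriv_const]
    simp_rw [hprod]
    rw [Finset.sum_add_distrib, ← Finset.mul_sum, hvan, mul_zero, zero_add]
  have hterm : ∀ b a, Integrable
      (fun x => Torus.partialDeriv a (fun y => v y b * Torus.partialDeriv b w y a) x) volume :=
    fun b a => ((hψ b a).partialDeriv a).integrable
  rw [integral_congr_ae (Filter.Eventually.of_forall fun x =>
    (Finset.sum_comm : ∑ a, ∑ b, Torus.partialDeriv a v x b * Torus.partialDeriv b w x a =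
      ∑ b, ∑ a, Torus.partialDeriv a v x b * Torus.partialDeriv b w x a))]
  simp_rw [hA]
  rw [integral_finsetSum _ fun b _ => integrable_finsetSum _ fun a _ => hterm b a]
  refine Finset.sum_eq_zero fun b _ => ?_
  rw [integral_finsetSum _ fun a _ => hterm b a]
  exact Finset.sum_eq_zero fun a _ => Torus.integral_partialDeriv_eq_zero_holds (hψ b a) a

/-- Green's first identity in bilinear form: `∑ₐ ∫⟪∂ₐv, ∂ₐw⟫ = −∫⟪Δv, w⟫` for smooth fields. [folklore] -/
private theorem sum_integral_inner_partialDeriv_eq_neg {v w : UnitAddTorus d → EuclideanSpace ℝ d}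
    (hv : Torus.IsSmooth v) (hw : Torus.IsSmooth w) :
    ∑ a, ∫ x, ⟪Torus.partialDeriv a v x, Torus.partialDeriv a w x⟫_ℝ =
      -∫ x, ⟪Torus.laplacian v x, w x⟫_ℝ := by
  simp_rw [Torus.laplacian_eq_sum_partialDeriv_partialDeriv hv, sum_inner]
  rw [integral_finsetSum _ fun i _ => (((hv.partialDeriv i).partialDeriv i).inner hw).integrable,
    ← Finset.sum_neg_distrib]
  refine Finset.sum_congr rfl fun i _ => ?_
  rw [_root_.Literature.Analysis.FunctionSpaces.Torus.integral_inner_partialDeriv_eq_neg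
    (hv.partialDeriv i) hw i, neg_neg]

/-- **The cross term `⟨S, ΔS⟩ = −‖S‖²_{Ḣ¹} = −½‖Δv‖₂²` on the torus**: for smooth divergence-free
`v` on `T^d`, `∫ ∑ₐᵦ Sₐᵦ (ΔS)ₐᵦ = −½ ∫‖Δv‖²` (the polarised strain isometry
`‖S‖²_{Ḣ¹} = ½‖∇u‖²_{Ḣ¹}`, Miller's Prop 2.5, combined with `⟨S, −ΔS⟩ = ‖S‖²_{Ḣ¹}`, the
expansion step of the proof of Prop 6.2: "f(ρ) = ‖S‖²₂ − 2‖S‖²_{Ḣ¹}ρ + ‖−ΔS‖²₂ρ²").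
[cite: Miller2026StrainVorticity, Prop 2.5 and Prop 6.2 (proof)] -/
theorem integral_sum_strain_mul_laplacianStrain_eq {v : UnitAddTorus d → EuclideanSpace ℝ d}
    (hv : Torus.IsSmooth v) (hdiv : Torus.IsDivFree v) :
    ∫ x, ∑ a, ∑ b, ((Torus.partialDeriv b v x a + Torus.partialDeriv a v x b) / 2) *
        ((Torus.partialDeriv a (Torus.laplacian v) x b + Torus.partialDeriv b (Torus.laplacian v) x a) / 2) =
      -(2⁻¹ * ∫ x, ‖Torus.laplacian v x‖ ^ 2) := by
  set w := Torus.laplacian v with hw_def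
  have hw : Torus.IsSmooth w := hv.laplacian
  have hdivw : Torus.IsDivFree w := Torus.IsDivFree.laplacian_of_isSmooth hv hdiv
  have hD : ∀ a b, Torus.IsSmooth (fun y => Torus.partialDeriv a v y b) := fun a b => (hv.partialDeriv a).apply b
  have hDw : ∀ a b, Torus.IsSmooth (fun y => Torus.partialDeriv a w y b) := fun a b => (hw.partialDeriv a).apply b
  -- pointwise expansion into the two bilinear sums
  have hpt : ∀ x, ∑ a, ∑ b, ((Torus.partialDeriv b v x a + Torus.partialDeriv a v x b) / 2) *
      ((Torus.partialDeriv a w x b + Torus.partialDeriv b w x a) / 2) =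
      2⁻¹ * (∑ a, ∑ b, Torus.partialDeriv a v x b * Torus.partialDeriv a w x b) +
        2⁻¹ * (∑ a, ∑ b, Torus.partialDeriv a v x b * Torus.partialDeriv b w x a) := by
    intro x
    have e1 : ∑ a, ∑ b, ((Torus.partialDeriv b v x a + Torus.partialDeriv a v x b) / 2) *
        ((Torus.partialDeriv a w x b + Torus.partialDeriv b w x a) / 2) =
        4⁻¹ * (∑ a, ∑ b, Torus.partialDeriv b v x a * Torus.partialDeriv a w x b) +
        4⁻¹ * (∑ a, ∑ b, Torus.partialDeriv b v x a * Torus.partialDeriv b w x a) +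
        4⁻¹ * (∑ a, ∑ b, Torus.partialDeriv a v x b * Torus.partialDeriv a w x b) +
        4⁻¹ * (∑ a, ∑ b, Torus.partialDeriv a v x b * Torus.partialDeriv b w x a) := by
      simp only [Finset.mul_sum, ← Finset.sum_add_distrib]
      refine Finset.sum_congr rfl fun a _ => Finset.sum_congr rfl fun b _ => ?_
      ring
    have e2 : ∑ a, ∑ b, Torus.partialDeriv b v x a * Torus.partialDeriv b w x a =
        ∑ a, ∑ b, Torus.partialDeriv a v x b * Torus.partialDeriv a w x b := Finset.sum_comm
    have e3 : ∑ a, ∑ b, Torus.partialDeriv b v x a * Torus.partialDeriv a w x b =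
        ∑ a, ∑ b, Torus.partialDeriv a v x b * Torus.partialDeriv b w x a := Finset.sum_comm
    rw [e1, e2, e3]; ring
  have hS1 : Torus.IsSmooth (fun x => ∑ a, ∑ b, Torus.partialDeriv a v x b * Torus.partialDeriv a w x b) := by
    have h : ∀ a b, Torus.IsSmooth (fun x => Torus.partialDeriv a v x b * Torus.partialDeriv a w x b) :=
      fun a b => (hD a b).mul (hDw a b)
    unfold Torus.IsSmooth at h ⊢
    exact ContDiff.sum fun a _ => ContDiff.sum fun b _ => h a b
  have hS2 : Torus.IsSmooth (fun x => ∑ a, ∑ b, Torus.partialDeriv a v x b * Torus.partialDeriv b w x a) := by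
    have h : ∀ a b, Torus.IsSmooth (fun x => Torus.partialDeriv a v x b * Torus.partialDeriv b w x a) :=
      fun a b => (hD a b).mul (hDw b a)
    unfold Torus.IsSmooth at h ⊢
    exact ContDiff.sum fun a _ => ContDiff.sum fun b _ => h a b
  -- the diagonal sum is `∑ₐ⟪∂ₐv, ∂ₐw⟫`
  have hinner : ∀ x, ∑ a, ∑ b, Torus.partialDeriv a v x b * Torus.partialDeriv a w x b =
      ∑ a, ⟪Torus.partialDeriv a v x, Torus.partialDeriv a w x⟫_ℝ := fun x =>
    Finset.sum_congr rfl fun a _ => by simp [PiLp.inner_apply, mul_comm]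
  have hI1 : ∫ x, ∑ a, ∑ b, Torus.partialDeriv a v x b * Torus.partialDeriv a w x b =
      -∫ x, ‖Torus.laplacian v x‖ ^ 2 := by
    simp_rw [hinner]
    rw [integral_finsetSum _ fun a _ => ((hv.partialDeriv a).inner (hw.partialDeriv a)).integrable,
      sum_integral_inner_partialDeriv_eq_neg hv hw]
    congr 1
    refine integral_congr_ae (Filter.Eventually.of_forall fun x => ?_)
    show ⟪w x, w x⟫_ℝ = ‖Torus.laplacian v x‖ ^ 2
    rw [hw_def, real_inner_self_eq_norm_sq]
  have hI2 : ∫ x, ∑ a, ∑ b, Torus.partialDeriv a v x b * Torus.partialDeriv b w x a = 0 :=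
    integral_sum_partialDeriv_mul_swap_eq_zero hv hw hdivw
  simp_rw [hpt]
  rw [integral_add (hS1.integrable.const_mul _) (hS2.integrable.const_mul _),
    MeasureTheory.integral_const_mul, MeasureTheory.integral_const_mul, hI1, hI2]
  ring

/-- **`‖ΔS‖²₂ = ½‖∇Δv‖²₂` on the torus** (the strain isometry `‖S‖²_{Ḣ^α} = ½‖∇u‖²_{Ḣ^α}`,
Miller's Prop 2.5, at the `Ḣ²` level; here: the strain of the divergence-free field `Δv`):
`∫ ∑ₐᵦ (ΔS)ₐᵦ² = ½ · Torus.gradNormSq (Δv)`. [cite: Miller2026StrainVorticity, Prop 2.5] -/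
theorem integral_sum_laplacianStrain_sq_eq {v : UnitAddTorus d → EuclideanSpace ℝ d}
    (hv : Torus.IsSmooth v) (hdiv : Torus.IsDivFree v) :
    ∫ x, ∑ a, ∑ b, ((Torus.partialDeriv a (Torus.laplacian v) x b +
        Torus.partialDeriv b (Torus.laplacian v) x a) / 2) ^ 2 =
      2⁻¹ * Torus.gradNormSq (Torus.laplacian v) := by
  have hw : Torus.IsSmooth (Torus.laplacian v) := hv.laplacian
  have hdivw : Torus.IsDivFree (Torus.laplacian v) := Torus.IsDivFree.laplacian_of_isSmooth hv hdiv
  have h := integral_strainNormSq_eq_torusEnstrophy hw hdivw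
  rw [torusEnstrophy] at h
  rw [← h]
  refine integral_congr_ae (Filter.Eventually.of_forall fun x => ?_)
  exact Finset.sum_congr rfl fun a _ => Finset.sum_congr rfl fun b _ => by rw [add_comm]

/-- **The quadratic polynomial of Prop 6.2 in ladder variables**: for smooth divergence-free `v`
on `T^d` and every `ρ`, `∫ ∑ₐᵦ (Sₐᵦ + ρ(ΔS)ₐᵦ)² = ½H₁ − ρH₂ + ½ρ²H₃` with `H₁ = ‖∇v‖₂²`
(`Torus.gradNormSq v`), `H₂ = ‖Δv‖₂²`, `H₃ = ‖∇Δv‖₂²` (`Torus.gradNormSq (Δv)`) — Miller's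
"`f(ρ) = ‖S‖²₂ − 2‖S‖²_{Ḣ¹}ρ + ‖−ΔS‖²₂ρ²`" with `‖S‖²₂ = ½H₁`, `‖S‖²_{Ḣ¹} = ½H₂`, `‖ΔS‖²₂ = ½H₃`.
[cite: Miller2026StrainVorticity, Prop 6.2 (proof)] -/
theorem integral_sum_shiftedStrain_sq_eq {v : UnitAddTorus d → EuclideanSpace ℝ d}
    (hv : Torus.IsSmooth v) (hdiv : Torus.IsDivFree v) (ρ : ℝ) :
    ∫ x, ∑ a, ∑ b, ((Torus.partialDeriv b v x a + Torus.partialDeriv a v x b) / 2 +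
        ρ * ((Torus.partialDeriv a (Torus.laplacian v) x b +
          Torus.partialDeriv b (Torus.laplacian v) x a) / 2)) ^ 2 =
      2⁻¹ * Torus.gradNormSq v - ρ * (∫ x, ‖Torus.laplacian v x‖ ^ 2) +
        2⁻¹ * ρ ^ 2 * Torus.gradNormSq (Torus.laplacian v) := by
  have hw : Torus.IsSmooth (Torus.laplacian v) := hv.laplacian
  have hD : ∀ a b, Torus.IsSmooth (fun y => Torus.partialDeriv a v y b) := fun a b => (hv.partialDeriv a).apply b
  have hDw : ∀ a b, Torus.IsSmooth (fun y => Torus.partialDeriv a (Torus.laplacian v) y b) :=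
    fun a b => (hw.partialDeriv a).apply b
  set S : d → d → UnitAddTorus d → ℝ := fun a b x =>
    (Torus.partialDeriv b v x a + Torus.partialDeriv a v x b) / 2 with hS
  set M : d → d → UnitAddTorus d → ℝ := fun a b x =>
    (Torus.partialDeriv a (Torus.laplacian v) x b + Torus.partialDeriv b (Torus.laplacian v) x a) / 2 with hM
  have hSs : ∀ a b, Torus.IsSmooth (S a b) := fun a b => ((hD b a).add (hD a b)).div_const 2
  have hMs : ∀ a b, Torus.IsSmooth (M a b) := fun a b => ((hDw a b).add (hDw b a)).div_const 2
  have hsum : ∀ {g : d → d → UnitAddTorus d → ℝ}, (∀ a b, Torus.IsSmooth (g a b)) →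
      Torus.IsSmooth (fun x => ∑ a, ∑ b, g a b x) := by
    intro g hg
    unfold Torus.IsSmooth at hg ⊢
    have hl : Torus.lift (fun x => ∑ a, ∑ b, g a b x) = fun z => ∑ a, ∑ b, Torus.lift (g a b) z := rfl
    rw [hl]
    exact ContDiff.sum fun a _ => ContDiff.sum fun b _ => hg a b
  have h1 : Torus.IsSmooth (fun x => ∑ a, ∑ b, S a b x ^ 2) := hsum fun a b => (hSs a b).pow 2
  have h2 : Torus.IsSmooth (fun x => ∑ a, ∑ b, S a b x * M a b x) := hsum fun a b => (hSs a b).mul (hMs a b)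
  have h3 : Torus.IsSmooth (fun x => ∑ a, ∑ b, M a b x ^ 2) := hsum fun a b => (hMs a b).pow 2
  have hpt : ∀ x, ∑ a, ∑ b, (S a b x + ρ * M a b x) ^ 2 =
      (∑ a, ∑ b, S a b x ^ 2) + (2 * ρ) * (∑ a, ∑ b, S a b x * M a b x) +
        ρ ^ 2 * (∑ a, ∑ b, M a b x ^ 2) := by
    intro x
    simp only [Finset.mul_sum, ← Finset.sum_add_distrib]
    refine Finset.sum_congr rfl fun a _ => Finset.sum_congr rfl fun b _ => ?_
    ring
  have hI1 : ∫ x, ∑ a, ∑ b, S a b x ^ 2 = 2⁻¹ * Torus.gradNormSq v := by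
    have h := integral_strainNormSq_eq_torusEnstrophy hv hdiv
    rw [torusEnstrophy] at h
    simpa only [hS] using h
  have hI2 : ∫ x, ∑ a, ∑ b, S a b x * M a b x = -(2⁻¹ * ∫ x, ‖Torus.laplacian v x‖ ^ 2) := by
    simpa only [hS, hM] using integral_sum_strain_mul_laplacianStrain_eq hv hdiv
  have hI3 : ∫ x, ∑ a, ∑ b, M a b x ^ 2 = 2⁻¹ * Torus.gradNormSq (Torus.laplacian v) := by
    simpa only [hM] using integral_sum_laplacianStrain_sq_eq hv hdiv
  have hgoal : ∫ x, ∑ a, ∑ b, (S a b x + ρ * M a b x) ^ 2 =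
      2⁻¹ * Torus.gradNormSq v - ρ * (∫ x, ‖Torus.laplacian v x‖ ^ 2) +
        2⁻¹ * ρ ^ 2 * Torus.gradNormSq (Torus.laplacian v) := by
    simp_rw [hpt]
    have hi1 : Integrable (fun x => ∑ a, ∑ b, S a b x ^ 2) volume := h1.integrable
    have hi2 : Integrable (fun x => (2 * ρ) * ∑ a, ∑ b, S a b x * M a b x) volume :=
      h2.integrable.const_mul _
    have hi3 : Integrable (fun x => ρ ^ 2 * ∑ a, ∑ b, M a b x ^ 2) volume := h3.integrable.const_mul _
    have hi12 : Integrable (fun x => (∑ a, ∑ b, S a b x ^ 2) +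
        (2 * ρ) * ∑ a, ∑ b, S a b x * M a b x) volume := hi1.add hi2
    rw [integral_add hi12 hi3, integral_add hi1 hi2, MeasureTheory.integral_const_mul,
      MeasureTheory.integral_const_mul, hI1, hI2, hI3]
    ring
  simpa only [hS, hM] using hgoal

end StrainAlmostEigen

/-- **Miller's Proposition 6.2 on the torus, in ladder variables** ("`inf_{ρ∈ℝ} ‖−ρΔS − S‖²₂ =
(1 − ‖S‖⁴_{Ḣ¹}/(‖S‖²₂‖−ΔS‖²₂)) ‖S‖²₂`", attained at `ρ₀ = ‖S‖²_{Ḣ¹}/‖−ΔS‖²₂`): for a smooth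
divergence-free field `v` on `T^d`,
`⨅ ρ, ∫ ∑ₐᵦ (Sₐᵦ + ρ(ΔS)ₐᵦ)² = ½ (H₁ − H₂²/H₃)`, `H₁ = ‖∇v‖₂²`, `H₂ = ‖Δv‖₂²`, `H₃ = ‖∇Δv‖₂²`
(the torus isometry `‖S‖²₂ = ½H₁`, `‖S‖²_{Ḣ¹} = ½H₂`, `‖ΔS‖²₂ = ½H₃`; by the ladder interpolation
`H₂² ≤ H₁H₃` the right side is nonnegative, and it reads `½H₁` when `H₃ = 0`, Lean's `x/0 = 0`
agreeing because then `H₂ = 0`). [cite: Miller2026StrainVorticity, Prop 6.2] -/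
theorem Torus.iInf_integral_sum_shiftedStrain_sq_eq {v : UnitAddTorus d → EuclideanSpace ℝ d}
    (hv : Torus.IsSmooth v) (hdiv : Torus.IsDivFree v) :
    ⨅ ρ : ℝ, ∫ x, ∑ a, ∑ b, ((Torus.partialDeriv b v x a + Torus.partialDeriv a v x b) / 2 +
        ρ * ((Torus.partialDeriv a (Torus.laplacian v) x b +
          Torus.partialDeriv b (Torus.laplacian v) x a) / 2)) ^ 2 =
      2⁻¹ * (Torus.gradNormSq v -
        (∫ x, ‖Torus.laplacian v x‖ ^ 2) ^ 2 / Torus.gradNormSq (Torus.laplacian v)) := by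
  set H₁ : ℝ := Torus.gradNormSq v with hH₁
  set H₂ : ℝ := ∫ x, ‖Torus.laplacian v x‖ ^ 2 with hH₂
  set H₃ : ℝ := Torus.gradNormSq (Torus.laplacian v) with hH₃
  have hf : ∀ ρ : ℝ, ∫ x, ∑ a, ∑ b, ((Torus.partialDeriv b v x a + Torus.partialDeriv a v x b) / 2 +
      ρ * ((Torus.partialDeriv a (Torus.laplacian v) x b +
        Torus.partialDeriv b (Torus.laplacian v) x a) / 2)) ^ 2 =
      2⁻¹ * H₁ - ρ * H₂ + 2⁻¹ * ρ ^ 2 * H₃ := fun ρ =>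
    StrainAlmostEigen.integral_sum_shiftedStrain_sq_eq hv hdiv ρ
  simp_rw [hf]
  have hH₃0 : 0 ≤ H₃ := Torus.gradNormSq_nonneg _
  have hinterp : H₂ ^ 2 ≤ H₁ * H₃ := Torus.sq_integral_norm_sq_laplacian_le hv
  rcases hH₃0.eq_or_lt with h0 | hpos
  · -- `H₃ = 0`: then `H₂ = 0` and the function is constant
    have hH₂ : H₂ = 0 := by
      have : H₂ ^ 2 ≤ 0 := by rw [← h0, mul_zero] at hinterp; exact hinterp
      exact pow_eq_zero_iff (n := 2) (by norm_num) |>.1 (le_antisymm this (sq_nonneg _))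
    rw [← h0, hH₂]
    simp
  · set m : ℝ := 2⁻¹ * (H₁ - H₂ ^ 2 / H₃) with hm
    have hlow : ∀ ρ : ℝ, m ≤ 2⁻¹ * H₁ - ρ * H₂ + 2⁻¹ * ρ ^ 2 * H₃ := by
      intro ρ
      have hsq : 0 ≤ 2⁻¹ * H₃ * (ρ - H₂ / H₃) ^ 2 := by positivity
      have e : 2⁻¹ * H₁ - ρ * H₂ + 2⁻¹ * ρ ^ 2 * H₃ = m + 2⁻¹ * H₃ * (ρ - H₂ / H₃) ^ 2 := by
        rw [hm]; field_simp; ring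
      linarith
    have hat : 2⁻¹ * H₁ - (H₂ / H₃) * H₂ + 2⁻¹ * (H₂ / H₃) ^ 2 * H₃ = m := by
      rw [hm]; field_simp; ring
    refine le_antisymm ?_ (le_ciInf hlow)
    exact (ciInf_le ⟨m, Set.forall_mem_range.2 hlow⟩ (H₂ / H₃)).trans hat.le

/-- **Corollary 6.3 in flux form at `q = 2` (`p = 4`), ladder variables**: on `T^d`, `card d = 3`,
for `ν > 0` there is `K ≥ 0` such that every smooth divergence-free `v` satisfies
`−ν‖Δv‖₂² + ∫⟪(v·∇)v, Δv⟫ ≤ K · (½(H₁ − H₂²/H₃))² · ‖∇v‖₂²` — Miller's (6.17)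
`∫₀^{T_max}(1 − ‖S‖⁴_{Ḣ¹}/(‖S‖²₂‖S‖²_{Ḣ²}))²‖S‖⁴₂ dt = +∞` read as a rate bound: the optimal shift
`ρ₀ = H₂/H₃` and the exact Frobenius majorant `Λ = |S + ρ₀ΔS|_F` in
`Torus.exists_enstrophyFlux_le_of_shiftedStrain_Lq_le` at `q = 2`.
[cite: Miller2026StrainVorticity, Cor 6.3] -/
theorem Torus.exists_enstrophyFlux_le_of_ladderDefect (hd : Fintype.card d = 3) {ν : ℝ}
    (hν : 0 < ν) :
    ∃ K : ℝ, 0 ≤ K ∧ ∀ (v : UnitAddTorus d → EuclideanSpace ℝ d), Torus.IsSmooth v →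
      Torus.IsDivFree v →
        -ν * (∫ x, ‖Torus.laplacian v x‖ ^ 2) + ∫ x, ⟪Torus.convect v v x, Torus.laplacian v x⟫_ℝ ≤
          K * (2⁻¹ * (Torus.gradNormSq v -
            (∫ x, ‖Torus.laplacian v x‖ ^ 2) ^ 2 / Torus.gradNormSq (Torus.laplacian v))) ^ 2 *
            Torus.gradNormSq v := by
  obtain ⟨K, hK0, hK⟩ := Torus.exists_enstrophyFlux_le_of_shiftedStrain_Lq_le (d := d) hd
    (q := 2) (by norm_num) hν
  refine ⟨K, hK0, fun v hv hdiv => ?_⟩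
  set H₁ : ℝ := Torus.gradNormSq v with hH₁
  set H₂ : ℝ := ∫ x, ‖Torus.laplacian v x‖ ^ 2 with hH₂
  set H₃ : ℝ := Torus.gradNormSq (Torus.laplacian v) with hH₃
  set ρ₀ : ℝ := H₂ / H₃ with hρ₀
  set m : ℝ := 2⁻¹ * (H₁ - H₂ ^ 2 / H₃) with hm
  -- the value of the quadratic at `ρ₀` is `m`
  have hval : ∫ x, ∑ a, ∑ b, ((Torus.partialDeriv b v x a + Torus.partialDeriv a v x b) / 2 +
      ρ₀ * ((Torus.partialDeriv a (Torus.laplacian v) x b +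
        Torus.partialDeriv b (Torus.laplacian v) x a) / 2)) ^ 2 = m := by
    rw [StrainAlmostEigen.integral_sum_shiftedStrain_sq_eq hv hdiv ρ₀, hm, hρ₀]
    have hH₃0 : 0 ≤ H₃ := Torus.gradNormSq_nonneg _
    rcases hH₃0.eq_or_lt with h0 | hpos
    · have hinterp : H₂ ^ 2 ≤ H₁ * H₃ := Torus.sq_integral_norm_sq_laplacian_le hv
      have hH₂ : H₂ = 0 := by
        have : H₂ ^ 2 ≤ 0 := by rw [← h0, mul_zero] at hinterp; exact hinterp
        exact pow_eq_zero_iff (n := 2) (by norm_num) |>.1 (le_antisymm this (sq_nonneg _))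
      rw [← h0, hH₂]; simp [hH₁]
    · field_simp; ring
  have hm0 : 0 ≤ m := by
    rw [← hval]
    exact integral_nonneg fun x => Finset.sum_nonneg fun a _ => Finset.sum_nonneg fun b _ => sq_nonneg _
  -- the exact Frobenius majorant
  set Λ : UnitAddTorus d → ℝ := fun x => Real.sqrt (∑ a, ∑ b,
    ((Torus.partialDeriv b v x a + Torus.partialDeriv a v x b) / 2 +
      ρ₀ * ((Torus.partialDeriv a (Torus.laplacian v) x b +
        Torus.partialDeriv b (Torus.laplacian v) x a) / 2)) ^ 2) with hΛ
  have hD : ∀ a b, Continuous fun y => Torus.partialDeriv a v y b := fun a b =>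
    ((hv.partialDeriv a).apply b).continuous
  have hDL : ∀ a b, Continuous fun y => Torus.partialDeriv a (Torus.laplacian v) y b := fun a b =>
    ((hv.laplacian.partialDeriv a).apply b).continuous
  have hQc : Continuous fun x => ∑ a, ∑ b,
      ((Torus.partialDeriv b v x a + Torus.partialDeriv a v x b) / 2 +
        ρ₀ * ((Torus.partialDeriv a (Torus.laplacian v) x b +
          Torus.partialDeriv b (Torus.laplacian v) x a) / 2)) ^ 2 :=
    continuous_finsetSum _ fun a _ => continuous_finsetSum _ fun b _ =>
      ((((hD b a).add (hD a b)).div_const 2).add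
        ((((hDL a b).add (hDL b a)).div_const 2).const_mul ρ₀)).pow 2
  have hΛc : Continuous Λ := Real.continuous_sqrt.comp hQc
  have hΛ0 : ∀ x, 0 ≤ Λ x := fun x => Real.sqrt_nonneg _
  have hQ0 : ∀ x, 0 ≤ ∑ a, ∑ b,
      ((Torus.partialDeriv b v x a + Torus.partialDeriv a v x b) / 2 +
        ρ₀ * ((Torus.partialDeriv a (Torus.laplacian v) x b +
          Torus.partialDeriv b (Torus.laplacian v) x a) / 2)) ^ 2 := fun x =>
    Finset.sum_nonneg fun a _ => Finset.sum_nonneg fun b _ => sq_nonneg _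
  have hΛsq : ∀ x, Λ x ^ 2 = ∑ a, ∑ b,
      ((Torus.partialDeriv b v x a + Torus.partialDeriv a v x b) / 2 +
        ρ₀ * ((Torus.partialDeriv a (Torus.laplacian v) x b +
          Torus.partialDeriv b (Torus.laplacian v) x a) / 2)) ^ 2 := fun x => Real.sq_sqrt (hQ0 x)
  have hmaj : ∀ x, ∑ a, ∑ b,
      ((Torus.partialDeriv b v x a + Torus.partialDeriv a v x b) / 2 +
        ρ₀ * ((Torus.partialDeriv a (Torus.laplacian v) x b +
          Torus.partialDeriv b (Torus.laplacian v) x a) / 2)) ^ 2 ≤ Λ x ^ 2 := fun x => (hΛsq x).ge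
  -- its `L²` norm is `√m`
  have hN : (∫ x, Λ x ^ (2 : ℝ)) ^ (1 / (2 : ℝ)) ≤ Real.sqrt m := by
    have e : ∫ x, Λ x ^ (2 : ℝ) = m := by
      rw [← hval]
      refine integral_congr_ae (Filter.Eventually.of_forall fun x => ?_)
      show Λ x ^ (2 : ℝ) = _
      rw [Real.rpow_two, hΛsq x]
    rw [e, Real.sqrt_eq_rpow]
  have h := hK v hv hdiv ρ₀ Λ hΛc hΛ0 hmaj (Real.sqrt m) (Real.sqrt_nonneg _) hN
  have e4 : Real.sqrt m ^ (2 * (2 : ℝ) / (2 * 2 - 3)) = m ^ 2 := by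
    rw [show (2 * (2 : ℝ) / (2 * 2 - 3)) = ((4 : ℕ) : ℝ) by norm_num, Real.rpow_natCast,
      show (4 : ℕ) = 2 * 2 by norm_num, pow_mul, Real.sq_sqrt hm0]
  rw [e4] at h
  simpa only [hm, hH₁, hH₂, hH₃] using h

end Literature.Analysis.FluidPDE
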